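import Mathlib.NumberTheory.Padics.Complex
import Mathlib.RingTheory.Polynomial.Cyclotomic.Eval
import Mathlib.RingTheory.Polynomial.Cyclotomic.Roots
import Mathlib.RingTheory.RootsOfUnity.AlgebraicallyClosed
import Mathlib.Analysis.Normed.Group.Ultra
import Mathlib.FieldTheory.Minpoly.IsConjRoot
import Mathlib.FieldTheory.Galois.Infinite
import Mathlib.GroupTheory.Index
import Mathlib.Analysis.Normed.Unbundled.SpectralNorm
import Mathlib.NumberTheory.Padics.PadicNumbers
import Mathlib.Analysis.SpecificLimits.Normed
import Mathlib.Analysis.Normed.Ring.InfiniteSum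
import Mathlib.Data.Nat.Choose.Sum
import Mathlib.Analysis.SpecificLimits.Basic
import Mathlib.NumberTheory.Padics.RingHoms
import Mathlib.Data.Nat.Choose.Dvd
import Mathlib.Algebra.Ring.GeomSum
import Literature.NumberTheory.GaloisRepresentations.PadicCharacterNthRoot
import Literature.NumberTheory.GaloisRepresentations.PadicAlgClPointsAutomaticContinuity
import Literature.NumberTheory.EllipticCurves.FormalGroupFrobeniusTypeProofs
import Literature.RingTheory.FormalGroups.HondaTypeFunctionalEquationII
import Literature.NumberTheory.EllipticCurves.Sprung2012.HondaSystemPadicBallFormalGroup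
import HarnessLib
/-!
# Honda systems at supersingular primes (Sprung 2012 Thm. 2.2 / Kobayashi 2003 §8), II: `p`-power roots of unity and the cyclotomic
# tower inside `ℚ̄_p`, its Galois action and layers, transport of local points along the layers, Kobayashi's logarithm `log_{F_ss}`
# and the integral isomorphism `F_ss ≅ Ê`, Honda points, tower points, surjectivity of the ball logarithm, cyclotomic integers, and
# Kobayashi's generation step (Kobayashi 2003 §8; Serre, Local Fields; Neukirch ANT)

**The cyclotomic tower in `ℚ̄_p` and Kobayashi's formal-group objects at a supersingular prime** (S. Kobayashi, Invent. Math. 152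
(2003) §8 [Kobayashi2003]; J.-P. Serre, *Local Fields* [SerreLocalFields1979]; J. Neukirch, *Algebraic Number Theory* [NeukirchANT1999];
J. Silverman, AEC (2009) IV [SilvermanAEC2009]): `p`-power roots of unity in the `p`-adic closure, the tower `ℚ_p(ζ_{p^{n+1}})`, its
Galois group and layers, transport of points along layers, the logarithm `log_{F_ss}` of the Honda formal group and the integral
isomorphism with `Ê`, Honda points and tower points, surjectivity of the ball logarithm, cyclotomic integers, Kobayashi's generation.
RE-HOMED into `Literature/` by the Hodge foundations lane (`lit-hodgefound`, seat p20, generation 41): verbatim DECLARATION-LEVEL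
ports, in dependency order, of the declarations of the modules `Summits/BirchSwinnertonDyer/{Rank1Residual/Additive, BirchSwinnertonDyer/Theorems}/PadicClosureCyclotomicRoots, PadicClosureCyclotomicTower, PadicClosureCyclotomicGalois, PadicLayerTransport, KobayashiLogFss, KobayashiHondaIso,
KobayashiLogFssValues, KobayashiHondaPoints, KobayashiTowerPoints, PadicBallLogSurj, PadicCyclotomicIntegers, KobayashiTowerGeneration.lean`
(BSD cells `b2b-bsdres` / `bsd-inputs`, where they certify `p`-adic analysis of formal groups and of the cyclotomic tower at a
supersingular prime — unconditional facts about elliptic curves over `ℚ` and `ℚ_p`, independent of the Birch–Swinnerton-Dyer conjecture),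
namespaces `Summit.BirchSwinnertonDyer.Rank1Residual.Additive` and `Summit.BirchSwinnertonDyer.BirchSwinnertonDyer.Theorems` BOTH
re-rooted as `Literature.NumberTheory.EllipticCurves.Sprung2012.Honda` (sub-namespaces `BallEval`, `PadicCyclotomicTower`, `HondaFss`,
`SprungHonda`, `SignedEC`, … kept).  The declarations of the cone that are already in `Literature/` (Kobayashi's signed local
conditions `localFixedPointsOfEmb`, `localPairTraceOfEmb`, `towerSubgroup`, … of
`NumberTheory/EllipticCurves/Kobayashi2003/CyclotomicTowerSignedSelmer.lean`) are IMPORTED, not duplicated.  Definitions are ported with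
their bodies (real `def`s: evaluation maps, ball points, logarithms, towers, transported points — no `Prop`-valued placeholder, no
named fact: D-0026 net debt 0 for this file); every declaration carries the citation of the printed step it formalises or serves;
imports Mathlib/Literature only.  The Summits originals stay in place (transitional duplication; twins = same short names under the two
Summits namespaces).  Nothing here bears on the Birch–Swinnerton-Dyer conjecture or any summit statement.
Builds on `HondaSystemPadicBallFormalGroup.lean`; consumed by the later files of the series (same directory).
-/

noncomputable section

/-!
## Part 1 — port of `Summits/BirchSwinnertonDyer/Rank1Residual/Additive/PadicClosureCyclotomicRoots.lean` (14 declarations kept)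

# The local cyclotomic tower INSIDE `ℚ̄_p = PadicAlgCl p`, I: a compatible system of `p`-power roots
# of unity `(ζ (m+1))^p = ζ m` and `‖ζ_{p^m} − 1‖^{φ(p^m)} = ‖p‖` — cell `b2b-bsdres`, CLASS-CLOSURE
# lane, class O10 — x1b GEN 33, class lead; file 18 of the local series (the field side of [K] §8.4,
# Kobayashi's tower `k_n = ℚ_p(ζ_{p^{n+1}})`; port of the tree's `PAdicHodge/CyclotomicTower.lean`
# from the `NormedAlgClosure F` of a local field to Mathlib's `PadicAlgCl p`)

(Port of the declarations listed in the Part header; the source module's docstring — cell bookkeeping of the BSD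
printed-inputs programme — is abridged to its title here.)
-/

section Part1

open scoped _root_.Classical _root_.IntermediateField
open _root_.Polynomial

namespace Literature.NumberTheory.EllipticCurves.Sprung2012.Honda

namespace PadicCyclotomicTower

variable (p : ℕ) [hp : Fact p.Prime]

/-! ## §1 A compatible system of `p`-power roots of unity in `ℚ̄_p` -/

/-- One step of the compatible system: a primitive `p^{m+1}`-th root of unity whose `p`-th power is
a GIVEN primitive `p^m`-th root of unity `z` (take any primitive `p^{m+1}`-th root `μ`; `μ^p` and
`z` are primitive `p^m`-th roots, so `z = (μ^p)^a` with `p ∤ a`, and `μ^a` works). [cite: Kobayashi2003, §8.4] -/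
theorem exists_primitiveRoot_pow_eq {m : ℕ} {z : PadicAlgCl p} (hz : IsPrimitiveRoot z (p ^ m)) :
    ∃ y : PadicAlgCl p, IsPrimitiveRoot y (p ^ (m + 1)) ∧ y ^ p = z := by
  obtain ⟨μ, hμ⟩ := HasEnoughRootsOfUnity.exists_primitiveRoot (PadicAlgCl p) (p ^ (m + 1))
  rcases Nat.eq_zero_or_pos m with rfl | hm
  · -- `z = 1`: any primitive `p`-th root
    rw [pow_zero] at hz
    refine ⟨μ, hμ, ?_⟩
    rw [IsPrimitiveRoot.one_right_iff] at hz
    rw [hz]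
    have h1 := hμ.pow_eq_one
    rwa [zero_add, pow_one] at h1
  have hμp : IsPrimitiveRoot (μ ^ p) (p ^ m) := by
    have := hμ.pow_of_dvd hp.out.ne_zero (dvd_pow_self p (Nat.succ_ne_zero m))
    rwa [pow_succ, Nat.mul_div_cancel _ hp.out.pos] at this
  obtain ⟨a, -, hapow⟩ := hμp.eq_pow_of_pow_eq_one hz.pow_eq_one
  have hcop : a.Coprime (p ^ m) := (hμp.pow_iff_coprime (pow_pos hp.out.pos m) a).mp (hapow ▸ hz)
  refine ⟨μ ^ a, hμ.pow_of_coprime a ?_, ?_⟩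
  · exact ((Nat.coprime_pow_right_iff hm _ _).mp hcop).pow_right _
  · rw [← pow_mul, mul_comm, pow_mul, hapow]

/-- **A compatible system of primitive `p^m`-th roots of unity in `ℚ̄_p`**: `ζ 0 = 1` and
`ζ (m + 1)` a primitive `p^{m+1}`-th root with `(ζ (m+1))^p = ζ m` (recursive choice). Kobayashi's
`ζ_{p^{n+1}}` is `ζ (n + 1)`. [cite: Kobayashi2003, §8.4 (k_n = ℚ_p(ζ_{p^{n+1}}))] -/
def zeta : ℕ → PadicAlgCl p
  | 0 => 1
  | m + 1 =>
    if h : IsPrimitiveRoot (zeta m) (p ^ m) then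
      (exists_primitiveRoot_pow_eq p h).choose else 1

/-- `ζ m` is a primitive `p^m`-th root of unity and `(ζ (m+1))^p = ζ m`. [cite: Kobayashi2003, §8.4] -/
theorem isPrimitiveRoot_zeta_and (m : ℕ) :
    IsPrimitiveRoot (zeta p m) (p ^ m) ∧ zeta p (m + 1) ^ p = zeta p m := by
  induction m with
  | zero =>
    have h0 : IsPrimitiveRoot (zeta p 0) (p ^ 0) := by
      rw [pow_zero]; exact IsPrimitiveRoot.one
    refine ⟨h0, ?_⟩
    show (if h : IsPrimitiveRoot (zeta p 0) (p ^ 0) then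
      (exists_primitiveRoot_pow_eq p h).choose else 1) ^ p = zeta p 0
    rw [dif_pos h0]
    exact (exists_primitiveRoot_pow_eq p h0).choose_spec.2
  | succ m ih =>
    have h1 : IsPrimitiveRoot (zeta p (m + 1)) (p ^ (m + 1)) := by
      show IsPrimitiveRoot (if h : IsPrimitiveRoot (zeta p m) (p ^ m) then
        (exists_primitiveRoot_pow_eq p h).choose else 1) (p ^ (m + 1))
      rw [dif_pos ih.1]
      exact (exists_primitiveRoot_pow_eq p ih.1).choose_spec.1
    refine ⟨h1, ?_⟩
    show (if h : IsPrimitiveRoot (zeta p (m + 1)) (p ^ (m + 1)) then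
      (exists_primitiveRoot_pow_eq p h).choose else 1) ^ p = zeta p (m + 1)
    rw [dif_pos h1]
    exact (exists_primitiveRoot_pow_eq p h1).choose_spec.2

/-- `ζ m` is a primitive `p^m`-th root of unity. [cite: Kobayashi2003, §8.4] -/
theorem isPrimitiveRoot_zeta (m : ℕ) : IsPrimitiveRoot (zeta p m) (p ^ m) :=
  (isPrimitiveRoot_zeta_and p m).1

/-- Compatibility: `(ζ (m+1))^p = ζ m`. [cite: Kobayashi2003, §8.4] -/
theorem zeta_succ_pow (m : ℕ) : zeta p (m + 1) ^ p = zeta p m :=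
  (isPrimitiveRoot_zeta_and p m).2

/-- `ζ 0 = 1`. [cite: Kobayashi2003, §8.4] -/
@[simp] theorem zeta_zero : zeta p 0 = 1 := rfl

/-- Compatibility along the tower: `(ζ (m + j))^{p^j} = ζ m`. [cite: Kobayashi2003, §8.4] -/
theorem zeta_add_pow (m j : ℕ) : zeta p (m + j) ^ p ^ j = zeta p m := by
  induction j with
  | zero => simp
  | succ j ih => rw [pow_succ', pow_mul, ← add_assoc, zeta_succ_pow, ih]

/-- Beyond the top: `(ζ m)^{p^j} = 1` for `m ≤ j`. [cite: Kobayashi2003, §8.4] -/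
theorem zeta_pow_eq_one_of_le {m j : ℕ} (h : m ≤ j) : zeta p m ^ p ^ j = 1 := by
  obtain ⟨i, rfl⟩ := Nat.exists_eq_add_of_le h
  rw [pow_add, pow_mul, (isPrimitiveRoot_zeta p m).pow_eq_one, one_pow]

/-- `‖ζ m‖ = 1` (a root of unity). [cite: Kobayashi2003, §8.4] -/
theorem norm_zeta (m : ℕ) : ‖zeta p m‖ = 1 :=
  (isOfFinOrder_iff_pow_eq_one.2 ⟨p ^ m, pow_pos hp.out.pos m,
    (isPrimitiveRoot_zeta p m).pow_eq_one⟩).norm_eq_one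

/-! ## §2 `‖ζ_{p^m} − 1‖^{φ(p^m)} = ‖p‖` -/

/-- All primitive `p^m`-th roots `μ` have the same `‖μ − 1‖` as `ζ m`. [cite: Kobayashi2003, §8.4] -/
theorem norm_sub_one_eq_of_isPrimitiveRoot {m : ℕ} {μ : PadicAlgCl p}
    (hμ : IsPrimitiveRoot μ (p ^ m)) : ‖μ - 1‖ = ‖zeta p m - 1‖ := by
  obtain ⟨i, -, rfl⟩ := (isPrimitiveRoot_zeta p m).eq_pow_of_pow_eq_one hμ.pow_eq_one
  obtain ⟨j, -, hj⟩ := hμ.eq_pow_of_pow_eq_one (isPrimitiveRoot_zeta p m).pow_eq_one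
  apply le_antisymm (Literature.NumberTheory.GaloisRepresentations.PadicAlgCl.norm_pow_sub_one_le (norm_zeta p m).le i)
  conv_lhs => rw [← hj]
  exact Literature.NumberTheory.GaloisRepresentations.PadicAlgCl.norm_pow_sub_one_le (by rw [norm_pow, norm_zeta, one_pow]) j

/-- **`‖ζ m − 1‖^{φ(p^m)} = ‖p‖`** for `m ≥ 1`: `∏ (1 − μ) = Φ_{p^m}(1) = p` over the primitive
`p^m`-th roots `μ`, all factors of the same absolute value. [cite: SerreLocalFields1979, Ch. IV §4] -/
theorem norm_zeta_sub_one_pow {m : ℕ} (hm : 1 ≤ m) :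
    ‖zeta p m - 1‖ ^ (p ^ m).totient = ‖(p : PadicAlgCl p)‖ := by
  obtain ⟨k, rfl⟩ := Nat.exists_eq_add_of_le' hm
  have hζ := isPrimitiveRoot_zeta p (k + 1)
  have heval : ((cyclotomic (p ^ (k + 1)) (PadicAlgCl p)).eval 1) = p :=
    eval_one_cyclotomic_prime_pow k
  rw [cyclotomic_eq_prod_X_sub_primitiveRoots hζ, eval_prod] at heval
  simp only [eval_sub, eval_X, eval_C] at heval
  have hnorm := congrArg (fun x : PadicAlgCl p => ‖x‖) heval
  simp only [norm_prod] at hnorm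
  rw [← hnorm]
  have hconst : ∀ μ ∈ primitiveRoots (p ^ (k + 1)) (PadicAlgCl p), ‖1 - μ‖ = ‖zeta p (k + 1) - 1‖ := by
    intro μ hμ
    rw [norm_sub_rev]
    exact norm_sub_one_eq_of_isPrimitiveRoot p ((mem_primitiveRoots (pow_pos hp.out.pos _)).mp hμ)
  rw [Finset.prod_congr rfl hconst, Finset.prod_const, hζ.card_primitiveRoots]

/-- `0 < ‖ζ m − 1‖` for `m ≥ 1`. [cite: Kobayashi2003, §8.4] -/
theorem norm_zeta_sub_one_pos {m : ℕ} (hm : 1 ≤ m) : 0 < ‖zeta p m - 1‖ := by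
  rw [norm_pos_iff, sub_ne_zero]
  intro h
  have h1 := (isPrimitiveRoot_zeta p m).pow_eq_one_iff_dvd 1
  rw [pow_one] at h1
  have : p ^ m ∣ 1 := h1.mp h
  have hp1 : 1 < p ^ m := Nat.one_lt_pow (by omega) hp.out.one_lt
  exact absurd (Nat.le_of_dvd one_pos this) (not_le.mpr hp1)

/-- `‖ζ m − 1‖ ≤ 1`. [cite: Kobayashi2003, §8.4] -/
theorem norm_zeta_sub_one_le_one (m : ℕ) : ‖zeta p m - 1‖ ≤ 1 := by
  rw [sub_eq_add_neg]
  refine (IsUltrametricDist.norm_add_le_max _ _).trans (max_le (norm_zeta p m).le ?_)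
  rw [norm_neg, norm_one]

/-- `‖ζ m − 1‖ < 1` for `m ≥ 1` (`‖ζ − 1‖^{φ} = ‖p‖ < 1`). [cite: Kobayashi2003, §8.4] -/
theorem norm_zeta_sub_one_lt_one {m : ℕ} (hm : 1 ≤ m) : ‖zeta p m - 1‖ < 1 := by
  by_contra h
  push Not at h
  have h1 : ‖zeta p m - 1‖ = 1 := le_antisymm (norm_zeta_sub_one_le_one p m) h
  have := norm_zeta_sub_one_pow p hm
  rw [h1, one_pow] at this
  exact absurd this.symm (Literature.NumberTheory.GaloisRepresentations.PadicAlgCl.norm_natCast_prime_pos_lt_one (p := p)).2.ne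

end PadicCyclotomicTower

end Literature.NumberTheory.EllipticCurves.Sprung2012.Honda

end Part1

/-!
## Part 2 — port of `Summits/BirchSwinnertonDyer/Rank1Residual/Additive/PadicClosureCyclotomicTower.lean` (19 declarations kept)

# The local cyclotomic tower INSIDE `ℚ̄_p = PadicAlgCl p`, II: orthogonality of the `π`-power basis,
# `minpoly_{ℚ_p} ζ_{p^m} = Φ_{p^m}` (`[ℚ_p(ζ_{p^m}) : ℚ_p] = φ(p^m)`), the layers `ℚ_p(ζ_{p^m})` and
# the Galois supply — cell `b2b-bsdres`, CLASS-CLOSURE lane, class O10 — x1b GEN 33, class lead;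
# file 19 of the local series (port of the second half of `PAdicHodge/CyclotomicTower.lean`)

(Port of the declarations listed in the Part header; the source module's docstring — cell bookkeeping of the BSD
printed-inputs programme — is abridged to its title here.)
-/

section Part2

open scoped _root_.Classical _root_.IntermediateField
open _root_.Polynomial

namespace Literature.NumberTheory.EllipticCurves.Sprung2012.Honda

namespace PadicCyclotomicTower

variable (p : ℕ) [hp : Fact p.Prime]

/-! ## §3 Orthogonality of the `π`-power basis and `minpoly ζ_{p^m} = Φ_{p^m}` -/

/-- The absolute values of the non-zero terms `c π^j` (`c ∈ ℚ_p`, `j < φ(p^m)`) are pairwise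
distinct (value group `p^ℤ` of `ℚ_p` versus `‖π‖^{φ(p^m)} = ‖p‖`). [cite: SerreLocalFields1979, Ch. IV §4] -/
theorem eq_of_norm_mul_norm_pow_eq {m : ℕ} (hm : 1 ≤ m) {c c' : ℚ_[p]} (hc : c ≠ 0)
    (hc' : c' ≠ 0) {j j' : ℕ} (hj : j < (p ^ m).totient) (hj' : j' < (p ^ m).totient)
    (h : ‖c‖ * ‖zeta p m - 1‖ ^ j = ‖c'‖ * ‖zeta p m - 1‖ ^ j') : j = j' := by
  set t : ℝ := ‖(p : PadicAlgCl p)‖ with ht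
  have ht0 : 0 < t := (Literature.NumberTheory.GaloisRepresentations.PadicAlgCl.norm_natCast_prime_pos_lt_one (p := p)).1
  have ht1 : t < 1 := (Literature.NumberTheory.GaloisRepresentations.PadicAlgCl.norm_natCast_prime_pos_lt_one (p := p)).2
  set φ : ℕ := (p ^ m).totient with hφ
  set π : PadicAlgCl p := zeta p m - 1 with hπdef
  have hπφ : ‖π‖ ^ φ = t := norm_zeta_sub_one_pow p hm
  -- `‖c‖ = t^v`, `‖c'‖ = t^{v'}` with `t = p⁻¹`
  have hnp : ‖(p : PadicAlgCl p)‖ = (p : ℝ)⁻¹ := by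
    rw [← map_natCast (algebraMap ℚ_[p] (PadicAlgCl p)) p]
    exact (PadicAlgCl.norm_extends (p := p) (p : ℚ_[p])).trans Padic.norm_p
  have hcv : ‖c‖ = t ^ c.valuation := by
    rw [Padic.norm_eq_zpow_neg_valuation hc, ht, hnp, inv_zpow', zpow_neg]
  have hcv' : ‖c'‖ = t ^ c'.valuation := by
    rw [Padic.norm_eq_zpow_neg_valuation hc', ht, hnp, inv_zpow', zpow_neg]
  set v : ℤ := c.valuation
  set v' : ℤ := c'.valuation
  have h2 := congrArg (fun x : ℝ => x ^ φ) h
  simp only [mul_pow] at h2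
  rw [← pow_mul, ← pow_mul, mul_comm j φ, mul_comm j' φ, pow_mul, pow_mul, hπφ, hcv, hcv',
    ← zpow_natCast (t ^ v) φ, ← zpow_natCast (t ^ v') φ, ← zpow_mul, ← zpow_mul,
    ← zpow_natCast t j, ← zpow_natCast t j', ← zpow_add₀ ht0.ne', ← zpow_add₀ ht0.ne'] at h2
  have hexp : v * (φ : ℤ) + (j : ℤ) = v' * (φ : ℤ) + (j' : ℤ) :=
    zpow_right_injective₀ ht0 ht1.ne h2
  have hdvd : (φ : ℤ) ∣ (j : ℤ) - j' := ⟨v' - v, by linear_combination hexp⟩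
  have habs : |(j : ℤ) - j'| < φ := by
    rw [abs_sub_lt_iff]; constructor <;> omega
  have := Int.eq_zero_of_abs_lt_dvd hdvd habs
  omega

/-- **Orthogonality of the `π`-power basis** (`π = ζ m − 1`): for `r ∈ ℚ_p[X]` of degree
`< φ(p^m)` every term is dominated by the sum, `‖r_j‖ ‖π‖^j ≤ ‖r(π)‖` (the non-zero terms have
pairwise distinct absolute values; Mathlib `IsUltrametricDist.norm_sum_eq_sup'_of_pairwise_ne`).
[cite: SerreLocalFields1979, Ch. IV §4] -/
theorem norm_coeff_mul_le_norm_aeval {m : ℕ} (hm : 1 ≤ m) (r : ℚ_[p][X])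
    (hr : r.natDegree < (p ^ m).totient) (j : ℕ) :
    ‖r.coeff j‖ * ‖zeta p m - 1‖ ^ j ≤ ‖aeval (zeta p m - 1) r‖ := by
  set π : PadicAlgCl p := zeta p m - 1 with hπdef
  by_cases hj0 : r.coeff j = 0
  · rw [hj0, norm_zero, zero_mul]; exact norm_nonneg _
  have hjdeg : j ≤ r.natDegree := le_natDegree_of_ne_zero hj0
  let f : ℕ → PadicAlgCl p := fun i => r.coeff i • π ^ i
  let S : Finset ℕ := (Finset.range (r.natDegree + 1)).filter fun i => r.coeff i ≠ 0
  have hsum : aeval π r = ∑ i ∈ S, f i := by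
    rw [aeval_eq_sum_range, Finset.sum_filter_of_ne]
    intro i _ hi h0
    apply hi
    change r.coeff i • π ^ i = 0
    rw [h0, zero_smul]
  have hjS : j ∈ S := by
    simp only [S, Finset.mem_filter, Finset.mem_range]
    exact ⟨Nat.lt_succ_of_le hjdeg, hj0⟩
  have hSne : S.Nonempty := ⟨j, hjS⟩
  have hnormf : ∀ i, ‖f i‖ = ‖r.coeff i‖ * ‖π‖ ^ i := fun i => by
    change ‖r.coeff i • π ^ i‖ = _
    rw [norm_smul, norm_pow]
  have hpair : Set.Pairwise (S : Set ℕ) fun i i' => ‖f i‖ ≠ ‖f i'‖ := by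
    intro i hi i' hi' hii' heq
    simp only [S, Finset.coe_filter, Finset.mem_range, Set.mem_setOf_eq] at hi hi'
    rw [hnormf, hnormf] at heq
    exact hii' (eq_of_norm_mul_norm_pow_eq p hm hi.2 hi'.2 (by omega) (by omega) heq)
  have key : ‖∑ i ∈ S, f i‖ = S.sup' hSne (fun i => ‖f i‖) :=
    IsUltrametricDist.norm_sum_eq_sup'_of_pairwise_ne hSne hpair
  rw [hsum, key, ← hnormf j]
  exact Finset.le_sup' (fun i => ‖f i‖) hjS

/-- `Φ_{p^m}(ζ m) = 0` over `ℚ_p`. [cite: SerreLocalFields1979, Ch. IV §4] -/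
theorem aeval_zeta_cyclotomic (m : ℕ) : aeval (zeta p m) (cyclotomic (p ^ m) ℚ_[p]) = 0 := by
  rw [aeval_def, eval₂_eq_eval_map, map_cyclotomic, ← IsRoot.def, isRoot_cyclotomic_iff]
  exact isPrimitiveRoot_zeta p m

/-- **`minpoly_{ℚ_p} (ζ m) = Φ_{p^m}`** (`m ≥ 1`): `minpoly ∣ Φ_{p^m}` and its degree is at least
`φ(p^m)` by orthogonality (a monic relation of degree `d < φ(p^m)` in `ζ` is one of degree `d` in
`π = ζ − 1` with leading coefficient `1`). So `Φ_{p^m}` is irreducible over `ℚ_p`.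
[cite: SerreLocalFields1979, Ch. IV §4] [cite: NeukirchANT1999, Ch. II (7.13)] -/
theorem minpoly_zeta {m : ℕ} (hm : 1 ≤ m) : minpoly ℚ_[p] (zeta p m) = cyclotomic (p ^ m) ℚ_[p] := by
  have hint : IsIntegral ℚ_[p] (zeta p m) := Algebra.IsIntegral.isIntegral _
  set q : ℚ_[p][X] := minpoly ℚ_[p] (zeta p m) with hq
  have hqmonic : q.Monic := minpoly.monic hint
  have hΦmonic : (cyclotomic (p ^ m) ℚ_[p]).Monic := cyclotomic.monic _ _
  have hdvd : q ∣ cyclotomic (p ^ m) ℚ_[p] := minpoly.dvd ℚ_[p] _ (aeval_zeta_cyclotomic p m)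
  have hdeg : (p ^ m).totient ≤ q.natDegree := by
    by_contra hlt
    push Not at hlt
    set r : ℚ_[p][X] := q.comp (X + 1) with hr
    have hX1 : (X + 1 : ℚ_[p][X]).natDegree = 1 := by rw [← C_1, natDegree_X_add_C]
    have hrdeg : r.natDegree = q.natDegree := by rw [hr, natDegree_comp, hX1, mul_one]
    have hrlead : r.coeff q.natDegree = 1 := by
      have h1 : r.leadingCoeff = 1 := by
        rw [hr, leadingCoeff_comp (by rw [hX1]; exact one_ne_zero), hqmonic.leadingCoeff,
          show (X + 1 : ℚ_[p][X]) = X + C 1 by rw [C_1], leadingCoeff_X_add_C, one_pow, one_mul]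
      rwa [leadingCoeff, hrdeg] at h1
    have hraeval : aeval (zeta p m - 1) r = 0 := by
      rw [hr, aeval_comp, map_add, aeval_X, map_one, sub_add_cancel, hq, minpoly.aeval]
    have h := norm_coeff_mul_le_norm_aeval p hm r (by rw [hrdeg]; exact hlt) q.natDegree
    rw [hrlead, norm_one, one_mul, hraeval, norm_zero] at h
    exact absurd h (not_le.mpr (pow_pos (norm_zeta_sub_one_pos p hm) _))
  have hΦdeg : (cyclotomic (p ^ m) ℚ_[p]).natDegree ≤ q.natDegree := by
    rw [natDegree_cyclotomic]; exact hdeg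
  exact (Polynomial.eq_of_monic_of_dvd_of_natDegree_le hqmonic hΦmonic hdvd hΦdeg).symm

/-- **The `m`-th layer `ℚ_p(ζ_{p^m}) ⊆ ℚ̄_p`** (Kobayashi's `k_{m−1}`; `layer 0 = ℚ_p`).
[cite: Kobayashi2003, §8.4] -/
def layer (m : ℕ) : IntermediateField ℚ_[p] (PadicAlgCl p) :=
  ℚ_[p]⟮zeta p m⟯

/-- Unfolding of `layer`. [cite: SerreLocalFields1979, Ch. IV §4] -/
theorem layer_def (m : ℕ) : layer p m = ℚ_[p]⟮zeta p m⟯ := rfl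

/-- `ζ m ∈ layer m`. [cite: SerreLocalFields1979, Ch. IV §4] -/
theorem zeta_mem_layer (m : ℕ) : zeta p m ∈ layer p m :=
  IntermediateField.mem_adjoin_simple_self _ _

/-- `layer 0 = ⊥ = ℚ_p`. [cite: SerreLocalFields1979, Ch. IV §4] -/
theorem layer_zero : layer p 0 = ⊥ := by
  rw [layer_def, zeta_zero, IntermediateField.adjoin_simple_eq_bot_iff]
  exact one_mem _

/-- The layers are finite over `ℚ_p` (a theorem, to be introduced with `haveI`). [cite: SerreLocalFields1979, Ch. IV §4] -/
theorem finiteDimensional_layer (m : ℕ) : FiniteDimensional ℚ_[p] (layer p m) :=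
  IntermediateField.adjoin.finiteDimensional (Algebra.IsIntegral.isIntegral _)

/-- **`[ℚ_p(ζ_{p^m}) : ℚ_p] = φ(p^m)`** (`m ≥ 1`). [cite: SerreLocalFields1979, Ch. IV §4] -/
theorem finrank_layer {m : ℕ} (hm : 1 ≤ m) : Module.finrank ℚ_[p] (layer p m) = (p ^ m).totient := by
  rw [layer_def, IntermediateField.adjoin.finrank (Algebra.IsIntegral.isIntegral _), minpoly_zeta p hm,
    natDegree_cyclotomic]

/-- The tower is increasing. [cite: SerreLocalFields1979, Ch. IV §4] -/
theorem layer_mono : Monotone (layer p) := by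
  intro m m' h
  obtain ⟨j, rfl⟩ := Nat.exists_eq_add_of_le h
  rw [layer_def, IntermediateField.adjoin_simple_le_iff, ← zeta_add_pow p m j]
  exact pow_mem (zeta_mem_layer p (m + j)) _

/-- **Elements of `layer m` are polynomials in `ζ m` of degree `< φ(p^m)`** over `ℚ_p`.
[cite: SerreLocalFields1979, Ch. IV §4] -/
theorem exists_aeval_zeta_eq {m : ℕ} {x : PadicAlgCl p} (hx : x ∈ layer p m) :
    ∃ r : ℚ_[p][X], r.natDegree < (p ^ m).totient ∧ aeval (zeta p m) r = x := by
  have halg : IsAlgebraic ℚ_[p] (zeta p m) := Algebra.IsAlgebraic.isAlgebraic _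
  have hx' : x ∈ (layer p m).toSubalgebra := hx
  rw [layer_def, IntermediateField.adjoin_simple_toSubalgebra_of_isAlgebraic halg,
    Algebra.adjoin_singleton_eq_range_aeval] at hx'
  obtain ⟨q, rfl⟩ := hx'
  have hΦmonic : (cyclotomic (p ^ m) ℚ_[p]).Monic := cyclotomic.monic _ _
  have hΦ1 : cyclotomic (p ^ m) ℚ_[p] ≠ 1 := by
    intro h
    have := congrArg natDegree h
    rw [natDegree_cyclotomic, natDegree_one] at this
    exact (Nat.totient_pos.mpr (pow_pos hp.out.pos m)).ne' this
  refine ⟨q %ₘ cyclotomic (p ^ m) ℚ_[p], ?_, ?_⟩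
  · rw [← natDegree_cyclotomic (p ^ m) ℚ_[p]]
    exact natDegree_modByMonic_lt q hΦmonic hΦ1
  · exact aeval_modByMonic_eq_self_of_root (aeval_zeta_cyclotomic p m)

/-- **Galois supply**: for `p ∤ a` there is `σ ∈ Aut(ℚ̄_p/ℚ_p)` with `σ (ζ m) = (ζ m)^a` (`ζ^a` is
a root of `Φ_{p^m} = minpoly ζ`; conjugates over `ℚ_p` are related by an automorphism of the normal
extension `ℚ̄_p/ℚ_p`, Mathlib `IsConjRoot.exists_algEquiv`). [cite: Tate1967, §3.1] -/
theorem exists_algEquiv_apply_zeta_eq_pow {m : ℕ} (hm : 1 ≤ m) {a : ℕ} (ha : a.Coprime p) :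
    ∃ σ : PadicAlgCl p ≃ₐ[ℚ_[p]] PadicAlgCl p, σ (zeta p m) = zeta p m ^ a := by
  have hprim : IsPrimitiveRoot (zeta p m ^ a) (p ^ m) :=
    (isPrimitiveRoot_zeta p m).pow_of_coprime a (ha.pow_right m)
  have hint : IsIntegral ℚ_[p] (zeta p m) := Algebra.IsIntegral.isIntegral _
  have hconj : IsConjRoot ℚ_[p] (zeta p m) (zeta p m ^ a) := by
    refine (isConjRoot_iff_mem_minpoly_aroots hint).mpr ?_
    rw [mem_aroots, minpoly_zeta p hm]
    refine ⟨(cyclotomic.monic _ _).ne_zero, ?_⟩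
    rw [aeval_def, eval₂_eq_eval_map, map_cyclotomic, ← IsRoot.def, isRoot_cyclotomic_iff]
    exact hprim
  obtain ⟨σ, hσ⟩ := hconj.exists_algEquiv
  exact ⟨σ.symm, σ.symm_apply_eq.mpr hσ.symm⟩

/-- Every automorphism maps `ζ m` to a power `(ζ m)^c`, `c < p^m`. [cite: SerreLocalFields1979, Ch. IV §4] -/
theorem exists_apply_zeta_eq_pow (σ : PadicAlgCl p ≃ₐ[ℚ_[p]] PadicAlgCl p) (m : ℕ) :
    ∃ c < p ^ m, σ (zeta p m) = zeta p m ^ c := by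
  have h1 : (σ (zeta p m)) ^ p ^ m = 1 := by
    rw [← map_pow, (isPrimitiveRoot_zeta p m).pow_eq_one, map_one]
  obtain ⟨c, hc, h⟩ := (isPrimitiveRoot_zeta p m).eq_pow_of_pow_eq_one h1
  exact ⟨c, hc, h.symm⟩

/-- **Two automorphisms with the same action on `ζ m` agree on `layer m`.** [cite: SerreLocalFields1979, Ch. IV §4] -/
theorem apply_eq_of_apply_zeta_eq {m : ℕ} {σ σ' : PadicAlgCl p ≃ₐ[ℚ_[p]] PadicAlgCl p}
    (h : σ (zeta p m) = σ' (zeta p m)) {x : PadicAlgCl p} (hx : x ∈ layer p m) : σ x = σ' x := by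
  have halg : IsAlgebraic ℚ_[p] (zeta p m) := Algebra.IsAlgebraic.isAlgebraic _
  have hx' : x ∈ (layer p m).toSubalgebra := hx
  rw [layer_def, IntermediateField.adjoin_simple_toSubalgebra_of_isAlgebraic halg] at hx'
  have hle : Algebra.adjoin ℚ_[p] {zeta p m} ≤
      AlgHom.equalizer (σ : PadicAlgCl p →ₐ[ℚ_[p]] PadicAlgCl p)
        (σ' : PadicAlgCl p →ₐ[ℚ_[p]] PadicAlgCl p) :=
    Algebra.adjoin_le (Set.singleton_subset_iff.mpr h)
  exact hle hx'

/-- An automorphism fixing `ζ m` fixes `layer m` pointwise. [cite: SerreLocalFields1979, Ch. IV §4] -/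
theorem apply_eq_self_of_apply_zeta_eq {m : ℕ} {σ : PadicAlgCl p ≃ₐ[ℚ_[p]] PadicAlgCl p}
    (h : σ (zeta p m) = zeta p m) {x : PadicAlgCl p} (hx : x ∈ layer p m) : σ x = x := by
  have := apply_eq_of_apply_zeta_eq p (σ' := 1) (by rw [h]; rfl) hx
  rw [this]; rfl

/-- The layers are stable under every automorphism. [cite: SerreLocalFields1979, Ch. IV §4] -/
theorem apply_mem_layer (σ : PadicAlgCl p ≃ₐ[ℚ_[p]] PadicAlgCl p) {m : ℕ} {x : PadicAlgCl p}
    (hx : x ∈ layer p m) : σ x ∈ layer p m := by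
  have halg : IsAlgebraic ℚ_[p] (zeta p m) := Algebra.IsAlgebraic.isAlgebraic _
  have hx' : x ∈ (layer p m).toSubalgebra := hx
  rw [layer_def, IntermediateField.adjoin_simple_toSubalgebra_of_isAlgebraic halg,
    Algebra.adjoin_singleton_eq_range_aeval] at hx'
  obtain ⟨q, rfl⟩ := hx'
  obtain ⟨c, -, hc⟩ := exists_apply_zeta_eq_pow p σ m
  change (σ : PadicAlgCl p →ₐ[ℚ_[p]] PadicAlgCl p) (aeval (zeta p m) q) ∈ layer p m
  have hy : zeta p m ^ c ∈ layer p m := pow_mem (zeta_mem_layer p m) c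
  rw [← aeval_algHom_apply]
  change aeval (σ (zeta p m)) q ∈ layer p m
  rw [hc, show zeta p m ^ c = ((⟨_, hy⟩ : layer p m) : PadicAlgCl p) from rfl,
    IntermediateField.aeval_coe]
  exact SetLike.coe_mem _

/-- **An element fixed by every automorphism fixing `ζ m` lies in `layer m`** (Galois
correspondence for `ℚ̄_p/ℚ_p`, Mathlib `InfiniteGalois.fixedField_fixingSubgroup`). [cite: SerreLocalFields1979, Ch. IV §4] -/
theorem mem_layer_of_forall_apply_eq {m : ℕ} {x : PadicAlgCl p}
    (hx : ∀ σ : PadicAlgCl p ≃ₐ[ℚ_[p]] PadicAlgCl p, σ (zeta p m) = zeta p m → σ x = x) :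
    x ∈ layer p m := by
  rw [← InfiniteGalois.fixedField_fixingSubgroup (layer p m)]
  intro σ
  have hσ : (σ : PadicAlgCl p ≃ₐ[ℚ_[p]] PadicAlgCl p) (zeta p m) = zeta p m := by
    have := σ.2
    rw [IntermediateField.mem_fixingSubgroup_iff] at this
    exact this _ (zeta_mem_layer p m)
  exact hx σ hσ

/-- Membership in the fixing subgroup of `layer m` is fixing `ζ m`. [cite: SerreLocalFields1979, Ch. IV §4] -/
theorem mem_fixingSubgroup_layer_iff {m : ℕ} (σ : PadicAlgCl p ≃ₐ[ℚ_[p]] PadicAlgCl p) :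
    σ ∈ (layer p m).fixingSubgroup ↔ σ (zeta p m) = zeta p m := by
  rw [IntermediateField.mem_fixingSubgroup_iff]
  exact ⟨fun h => h _ (zeta_mem_layer p m), fun h x hx => apply_eq_self_of_apply_zeta_eq p h hx⟩

end PadicCyclotomicTower

end Literature.NumberTheory.EllipticCurves.Sprung2012.Honda

end Part2

/-!
## Part 3 — port of `Summits/BirchSwinnertonDyer/Rank1Residual/Additive/PadicClosureCyclotomicGalois.lean` (21 declarations kept)

# The local cyclotomic tower INSIDE `ℚ̄_p = PadicAlgCl p`, III: the stabilisers
# `Γ_n = Stab(ζ_{p^n}) ≤ Gal(ℚ̄_p/ℚ_p)` (normal — as a theorem, antitone, of index `φ(p^n)`, `[Γ_n : Γ_{n+1}] = p`),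
# the Galois correspondence `ℚ̄_p^{Γ_n} = ℚ_p(ζ_{p^n})`, and the TRACE SUMS
# `∑_{Γ_n/Γ_{n+1}} σ(ζ_{p^{n+1}} − 1) = −p` — cell `b2b-bsdres`, CLASS-CLOSURE lane, class O10 — x1b
# GEN 33, class lead; file 20 of the local series (the Galois side of [K] Lemma 8.9:
# `Tr_{n+1/n}(ζ_{p^{n+2}} − 1) = −p`, `Tr_{k_0/ℚ_p}(ζ_p − 1) = −p`)

(Port of the declarations listed in the Part header; the source module's docstring — cell bookkeeping of the BSD
printed-inputs programme — is abridged to its title here.)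
-/

section Part3

open scoped _root_.Classical _root_.IntermediateField
open _root_.Polynomial

namespace Literature.NumberTheory.EllipticCurves.Sprung2012.Honda

namespace PadicCyclotomicTower

open _root_.Field Field.absoluteGaloisGroup

variable (p : ℕ) [hp : Fact p.Prime]

/-! ## §5 The stabilisers `stab p m ≤ Γ_{ℚ_p}` -/

/-- **The stabiliser of `ζ_{p^m}` in `Γ = Gal(ℚ̄_p/ℚ_p)`** (= `Gal(ℚ̄_p/ℚ_p(ζ_{p^m}))`; Kobayashi's
`Gal(ℚ̄_p/k_{m−1})`, and `stab p 0 = Γ` for `k_{−1} = ℚ_p`). [cite: Kobayashi2003, §8.4] -/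
def stab (m : ℕ) : Subgroup (absoluteGaloisGroup ℚ_[p]) :=
  MulAction.stabilizer (absoluteGaloisGroup ℚ_[p]) (zeta p m)

variable {p}

/-- Membership in `stab p m`: `σ • ζ m = ζ m`. [cite: Kobayashi2003, Lemma 8.9 (proof)] -/
theorem mem_stab_iff {m : ℕ} (σ : absoluteGaloisGroup ℚ_[p]) :
    σ ∈ stab p m ↔ σ • zeta p m = zeta p m :=
  MulAction.mem_stabilizer_iff

/-- Membership in `stab p m` through the underlying automorphism. [cite: Kobayashi2003, Lemma 8.9 (proof)] -/
theorem mem_stab_iff_toAlgEquiv {m : ℕ} (σ : absoluteGaloisGroup ℚ_[p]) :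
    σ ∈ stab p m ↔ toAlgEquiv ℚ_[p] σ (zeta p m) = zeta p m :=
  MulAction.mem_stabilizer_iff

variable (p)

/-- `stab p 0 = ⊤` (`ζ 0 = 1`). [cite: Kobayashi2003, Lemma 8.9 (proof)] -/
theorem stab_zero : stab p 0 = ⊤ := by
  ext σ
  simp only [mem_stab_iff, zeta_zero, smul_one, Subgroup.mem_top]

/-- The stabilisers decrease: `stab p m' ≤ stab p m` for `m ≤ m'` (`ζ m = (ζ m')^{p^{m'−m}}`).
[cite: Kobayashi2003, Lemma 8.9 (proof)] -/
theorem stab_antitone : Antitone (stab p) := by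
  intro m m' h σ hσ
  obtain ⟨j, rfl⟩ := Nat.exists_eq_add_of_le h
  rw [mem_stab_iff] at hσ ⊢
  rw [← zeta_add_pow p m j, smul_pow', hσ]

variable {p}

/-- An element of `stab p m` fixes `layer p m` pointwise. [cite: Kobayashi2003, Lemma 8.9 (proof)] -/
theorem smul_eq_self_of_mem_stab {m : ℕ} {σ : absoluteGaloisGroup ℚ_[p]} (hσ : σ ∈ stab p m)
    {x : PadicAlgCl p} (hx : x ∈ layer p m) : σ • x = x := by
  rw [smul_def]
  exact apply_eq_self_of_apply_zeta_eq p ((mem_stab_iff_toAlgEquiv σ).mp hσ) hx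

/-- **Galois correspondence on the layers**: `x ∈ layer p m ↔ x` is fixed by `stab p m`
(`ℚ̄_p^{Stab ζ_{p^m}} = ℚ_p(ζ_{p^m})`). [cite: NeukirchANT1999, Ch. IV §1] -/
theorem mem_layer_iff_forall_smul_eq {m : ℕ} (x : PadicAlgCl p) :
    x ∈ layer p m ↔ ∀ σ ∈ stab p m, σ • x = x := by
  refine ⟨fun hx σ hσ => smul_eq_self_of_mem_stab hσ hx, fun h => ?_⟩
  refine mem_layer_of_forall_apply_eq p fun τ hτ => ?_
  have hmem : (toAlgEquiv ℚ_[p]).symm τ ∈ stab p m := by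
    rw [mem_stab_iff, toAlgEquiv_symm_apply]; exact hτ
  have := h _ hmem
  rwa [toAlgEquiv_symm_apply] at this

/-- The layers are `Γ`-stable. [cite: Kobayashi2003, Lemma 8.9 (proof)] -/
theorem smul_mem_layer {m : ℕ} (σ : absoluteGaloisGroup ℚ_[p]) {x : PadicAlgCl p}
    (hx : x ∈ layer p m) : σ • x ∈ layer p m := by
  rw [smul_def]; exact apply_mem_layer p _ hx

/-- **`stab p m` is normal in `Γ`** (the layer is Galois over `ℚ_p`: `σ⁻¹ ζ ∈ layer m` is fixed by
every `τ ∈ stab m`). [cite: NeukirchANT1999, Ch. IV §1] -/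
theorem normal_stab (m : ℕ) : (stab p m).Normal := by
  refine ⟨fun τ hτ σ => ?_⟩
  rw [mem_stab_iff, mul_smul, mul_smul]
  have h1 : σ⁻¹ • zeta p m ∈ layer p m := smul_mem_layer σ⁻¹ (zeta_mem_layer p m)
  rw [smul_eq_self_of_mem_stab hτ h1, smul_inv_smul]

/-- `stab p m` is the pull-back of the fixing subgroup of `layer p m` along the identification
`Γ = Aut(ℚ̄_p/ℚ_p)`. [cite: Kobayashi2003, Lemma 8.9 (proof)] -/
theorem stab_eq_comap_fixingSubgroup (m : ℕ) :
    stab p m = ((layer p m).fixingSubgroup).comap (toAlgEquiv ℚ_[p]).toMonoidHom := by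
  ext σ
  rw [Subgroup.mem_comap, MulEquiv.coe_toMonoidHom, mem_fixingSubgroup_layer_iff,
    mem_stab_iff_toAlgEquiv]

variable (p)

/-- **`[Γ : stab p m] = φ(p^m)`** for `m ≥ 1` (`= [ℚ_p(ζ_{p^m}) : ℚ_p]`, Mathlib
`IntermediateField.finrank_eq_fixingSubgroup_index`). [cite: SerreLocalFields1979, Ch. IV §4] -/
theorem index_stab {m : ℕ} (hm : 1 ≤ m) : (stab p m).index = (p ^ m).totient := by
  rw [stab_eq_comap_fixingSubgroup, Subgroup.index_comap_of_surjective _ (toAlgEquiv ℚ_[p]).surjective,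
    ← IntermediateField.finrank_eq_fixingSubgroup_index, finrank_layer p hm]

/-- `[Γ : stab p 0] = 1`. [cite: Kobayashi2003, Lemma 8.9 (proof)] -/
theorem index_stab_zero : (stab p 0).index = 1 := by
  rw [stab_zero, Subgroup.index_top]

/-- `[Γ : stab p m] = φ(p^m)` for all `m` (`φ(1) = 1`). [cite: Kobayashi2003, Lemma 8.9 (proof)] -/
theorem index_stab' (m : ℕ) : (stab p m).index = (p ^ m).totient := by
  rcases Nat.eq_zero_or_pos m with rfl | hm
  · rw [index_stab_zero, pow_zero, Nat.totient_one]
  · exact index_stab p hm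

/-- **The relative index `[stab p m : stab p (m+1)] = φ(p^{m+1})/φ(p^m)`**, i.e. `p` for `m ≥ 1`
and `p − 1` for `m = 0` (`[k_m : k_{m−1}] = p`, `[k_0 : ℚ_p] = p − 1`). [cite: Kobayashi2003, §8.4]
[cite: SerreLocalFields1979, Ch. IV §4] -/
theorem index_subgroupOf_stab_succ (m : ℕ) :
    ((stab p (m + 1)).subgroupOf (stab p m)).index = if m = 0 then p - 1 else p := by
  have hrel : ((stab p (m + 1)).subgroupOf (stab p m)).index * (stab p m).index =
      (stab p (m + 1)).index :=
    Subgroup.relIndex_mul_index (stab_antitone p (Nat.le_succ m))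
  rw [index_stab', index_stab'] at hrel
  rcases Nat.eq_zero_or_pos m with rfl | hm
  · rw [if_pos rfl]
    rw [pow_zero, Nat.totient_one, mul_one, zero_add, pow_one, Nat.totient_prime hp.out] at hrel
    exact hrel
  · rw [if_neg hm.ne']
    obtain ⟨k, rfl⟩ := Nat.exists_eq_add_of_le' hm
    rw [Nat.totient_prime_pow_succ hp.out, Nat.totient_prime_pow_succ hp.out, pow_succ] at hrel
    have hne : p ^ k * (p - 1) ≠ 0 :=
      mul_ne_zero (pow_ne_zero k hp.out.ne_zero) (Nat.sub_ne_zero_of_lt hp.out.one_lt)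
    apply mul_right_cancel₀ hne
    rw [hrel]; ring

/-! ## §6 Trace sums over `stab p m / stab p (m+1)` -/

/-- A sum over an injective family whose values exhaust a finset of the same size is the sum
over that finset. [cite: Kobayashi2003, Lemma 8.9 (proof)] -/
theorem sum_eq_finset_sum_of_injective {ι : Type*} [Fintype ι] {f : ι → PadicAlgCl p}
    (hf : Function.Injective f) (T : Finset (PadicAlgCl p)) (hT : ∀ i, f i ∈ T)
    (hcard : Fintype.card ι = T.card) : ∑ i, f i = ∑ t ∈ T, t := by
  have himg : (Finset.univ : Finset ι).image f = T := by
    refine Finset.eq_of_subset_of_card_le (fun t ht => ?_) ?_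
    · obtain ⟨i, -, rfl⟩ := Finset.mem_image.mp ht
      exact hT i
    · rw [Finset.card_image_of_injective _ hf, Finset.card_univ, hcard]
  rw [← himg, Finset.sum_image fun i _ j _ h => hf h]

variable {p}

/-- The coset sum is injective on representatives: `q̃ • ζ (m+1) = q̃' • ζ (m+1) ⟹ q = q'`. [cite: Kobayashi2003, Lemma 8.9 (proof)] -/
theorem out_smul_zeta_injective (m : ℕ) :
    Function.Injective fun q : stab p m ⧸ (stab p (m + 1)).subgroupOf (stab p m) =>
      ((q.out : stab p m) : absoluteGaloisGroup ℚ_[p]) • zeta p (m + 1) := by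
  intro q q' h
  simp only at h
  rw [← QuotientGroup.out_eq' q, ← QuotientGroup.out_eq' q', QuotientGroup.eq, Subgroup.mem_subgroupOf,
    Subgroup.coe_mul, Subgroup.coe_inv, mem_stab_iff, mul_smul, ← h, inv_smul_smul]

/-- **For `x` fixed by `stab p m` the coset sum is multiplication by the index.** [cite: Kobayashi2003, Lemma 8.9 (proof)] -/
theorem sum_out_smul_of_forall_smul_eq (m : ℕ)
    [Fintype (stab p m ⧸ (stab p (m + 1)).subgroupOf (stab p m))] {x : PadicAlgCl p}
    (hx : ∀ σ ∈ stab p m, σ • x = x) :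
    ∑ q : stab p m ⧸ (stab p (m + 1)).subgroupOf (stab p m),
        ((q.out : stab p m) : absoluteGaloisGroup ℚ_[p]) • x =
      ((stab p (m + 1)).subgroupOf (stab p m)).index • x := by
  have : ∀ q : stab p m ⧸ (stab p (m + 1)).subgroupOf (stab p m),
      ((q.out : stab p m) : absoluteGaloisGroup ℚ_[p]) • x = x := fun q => hx _ q.out.2
  simp_rw [this, Finset.sum_const, Finset.card_univ, Subgroup.index, Nat.card_eq_fintype_card]

variable (p)

/-- A Galois conjugate of `ζ (m+1)` over `layer m` (`m ≥ 1`) is `ζ (m+1) · ω^j` with `ω = ζ 1`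
the primitive `p`-th root of the system, `j < p`. [cite: Kobayashi2003, Lemma 8.9 (proof)] -/
theorem exists_smul_zeta_succ_eq_mul_pow {m : ℕ} {σ : absoluteGaloisGroup ℚ_[p]} (hσ : σ ∈ stab p m) :
    ∃ j < p, σ • zeta p (m + 1) = zeta p (m + 1) * zeta p 1 ^ j := by
  have hζ0 : zeta p (m + 1) ≠ 0 := (isPrimitiveRoot_zeta p (m + 1)).ne_zero (NeZero.ne _)
  have hω : IsPrimitiveRoot (zeta p 1) p := by simpa using isPrimitiveRoot_zeta p 1
  set y := σ • zeta p (m + 1) with hy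
  have hyp : y ^ p = zeta p (m + 1) ^ p := by
    rw [hy, ← smul_pow', zeta_succ_pow, (mem_stab_iff σ).mp hσ]
  have hμ : (y * (zeta p (m + 1))⁻¹) ^ p = 1 := by
    rw [mul_pow, hyp, inv_pow, mul_inv_cancel₀ (pow_ne_zero _ hζ0)]
  haveI : NeZero p := ⟨hp.out.ne_zero⟩
  obtain ⟨j, hj, hjy⟩ := hω.eq_pow_of_pow_eq_one hμ
  refine ⟨j, hj, ?_⟩
  rw [hjy, mul_comm, inv_mul_cancel_right₀ hζ0]

/-- **`∑_{stab m / stab (m+1)} q̃ • ζ (m+1) = 0` for `m ≥ 1`** (`Tr_{k_m/k_{m−1}} ζ_{p^{m+1}} = 0`: the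
conjugates are the `ζ (m+1) ω^j`, `j < p`, and `∑_{j<p} ω^j = 0`). [cite: Kobayashi2003, Lemma 8.9 (proof)] -/
theorem sum_out_smul_zeta_succ_of_pos {m : ℕ} (hm : 1 ≤ m)
    [Fintype (stab p m ⧸ (stab p (m + 1)).subgroupOf (stab p m))] :
    ∑ q : stab p m ⧸ (stab p (m + 1)).subgroupOf (stab p m),
        ((q.out : stab p m) : absoluteGaloisGroup ℚ_[p]) • zeta p (m + 1) = 0 := by
  have hω : IsPrimitiveRoot (zeta p 1) p := by simpa using isPrimitiveRoot_zeta p 1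
  have hζ0 : zeta p (m + 1) ≠ 0 := (isPrimitiveRoot_zeta p (m + 1)).ne_zero (NeZero.ne _)
  set T : Finset (PadicAlgCl p) :=
    (Finset.range p).image fun j => zeta p (m + 1) * zeta p 1 ^ j with hT
  have hinj : Set.InjOn (fun j => zeta p (m + 1) * zeta p 1 ^ j) (Finset.range p : Set ℕ) := by
    intro j hj j' hj' h
    simp only [Finset.coe_range, Set.mem_Iio] at hj hj'
    exact hω.pow_inj hj hj' (mul_left_cancel₀ hζ0 h)
  have hTcard : T.card = p := by rw [hT, Finset.card_image_of_injOn hinj, Finset.card_range]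
  have hQcard : Fintype.card (stab p m ⧸ (stab p (m + 1)).subgroupOf (stab p m)) = T.card := by
    rw [hTcard, ← Nat.card_eq_fintype_card, ← Subgroup.index, index_subgroupOf_stab_succ, if_neg]
    omega
  rw [sum_eq_finset_sum_of_injective p (out_smul_zeta_injective m) T (fun q => ?_) hQcard]
  · rw [hT, Finset.sum_image hinj, ← Finset.mul_sum, hω.geom_sum_eq_zero hp.out.one_lt, mul_zero]
  · obtain ⟨j, hj, hjq⟩ := exists_smul_zeta_succ_eq_mul_pow p (q.out).2
    rw [hT, Finset.mem_image]
    exact ⟨j, Finset.mem_range.mpr hj, hjq.symm⟩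

/-- **`∑_{Γ / stab 1} q̃ • ζ 1 = −1`** (`Tr_{ℚ_p(ζ_p)/ℚ_p} ζ_p = −1`: the conjugates are all the
primitive `p`-th roots `ζ^a`, `1 ≤ a < p`). [cite: Kobayashi2003, Lemma 8.9 (proof)] -/
theorem sum_out_smul_zeta_one [Fintype (stab p 0 ⧸ (stab p 1).subgroupOf (stab p 0))] :
    ∑ q : stab p 0 ⧸ (stab p 1).subgroupOf (stab p 0),
        ((q.out : stab p 0) : absoluteGaloisGroup ℚ_[p]) • zeta p 1 = -1 := by
  have hω : IsPrimitiveRoot (zeta p 1) p := by simpa using isPrimitiveRoot_zeta p 1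
  haveI : NeZero p := ⟨hp.out.ne_zero⟩
  set T : Finset (PadicAlgCl p) := (Finset.Ico 1 p).image fun a => zeta p 1 ^ a with hT
  have hinj : Set.InjOn (fun a => zeta p 1 ^ a) (Finset.Ico 1 p : Set ℕ) := by
    intro a ha a' ha' h
    simp only [Finset.coe_Ico, Set.mem_Ico] at ha ha'
    exact hω.pow_inj ha.2 ha'.2 h
  have hTcard : T.card = p - 1 := by rw [hT, Finset.card_image_of_injOn hinj, Nat.card_Ico]
  have hQcard : Fintype.card (stab p 0 ⧸ (stab p 1).subgroupOf (stab p 0)) = T.card := by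
    rw [hTcard, ← Nat.card_eq_fintype_card, ← Subgroup.index, index_subgroupOf_stab_succ, if_pos rfl]
  rw [sum_eq_finset_sum_of_injective p (out_smul_zeta_injective 0) T (fun q => ?_) hQcard]
  · rw [hT, Finset.sum_image hinj]
    have h := hω.geom_sum_eq_zero hp.out.one_lt
    rw [Finset.range_eq_Ico, Finset.sum_eq_sum_Ico_succ_bot hp.out.pos, pow_zero] at h
    linear_combination h
  · -- `q̃ • ζ_p` is a primitive `p`-th root, i.e. `ζ_p^a` with `1 ≤ a < p`
    set σ : absoluteGaloisGroup ℚ_[p] := ((q.out : stab p 0) : absoluteGaloisGroup ℚ_[p])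
    have hprim : IsPrimitiveRoot (σ • zeta p 1) p := by
      rw [smul_def]
      exact hω.map_of_injective (toAlgEquiv ℚ_[p] σ).injective
    obtain ⟨a, ha, hay⟩ := hω.eq_pow_of_pow_eq_one hprim.pow_eq_one
    have ha0 : a ≠ 0 := by
      rintro rfl
      rw [pow_zero] at hay
      exact hprim.ne_one hp.out.one_lt hay.symm
    rw [hT, Finset.mem_image]
    exact ⟨a, Finset.mem_Ico.mpr ⟨Nat.pos_of_ne_zero ha0, ha⟩, hay⟩

/-- **Kobayashi's trace computation, uniform in the layer**: for EVERY `m ≥ 0`,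
`∑_{stab m / stab (m+1)} q̃ • (ζ (m+1) − 1) = −p` (for `m ≥ 1`: `0 − p·1`; for `m = 0`:
`−1 − (p−1)·1`) — the identities `Tr_{n+1/n}(ζ_{p^{n+2}} − 1) = −p` and `Tr_{k_0/ℚ_p}(ζ_p − 1) = −p`
behind `Tr_{n+1/n} c_{n+1} = −c_{n−1}` in Lemma 8.9. [cite: Kobayashi2003, Lemma 8.9 (proof)] -/
theorem sum_out_smul_zeta_succ_sub_one (m : ℕ)
    [Fintype (stab p m ⧸ (stab p (m + 1)).subgroupOf (stab p m))] :
    ∑ q : stab p m ⧸ (stab p (m + 1)).subgroupOf (stab p m),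
        ((q.out : stab p m) : absoluteGaloisGroup ℚ_[p]) • (zeta p (m + 1) - 1) =
      -(p : PadicAlgCl p) := by
  simp_rw [smul_sub, Finset.sum_sub_distrib, smul_one]
  rw [Finset.sum_const, Finset.card_univ, ← Nat.card_eq_fintype_card, ← Subgroup.index,
    index_subgroupOf_stab_succ]
  rcases Nat.eq_zero_or_pos m with rfl | hm
  · rw [sum_out_smul_zeta_one, if_pos rfl, nsmul_eq_mul, mul_one, Nat.cast_sub hp.out.one_lt.le,
      Nat.cast_one]
    ring
  · rw [sum_out_smul_zeta_succ_of_pos p hm, if_neg hm.ne', nsmul_eq_mul, mul_one]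
    ring

end PadicCyclotomicTower

end Literature.NumberTheory.EllipticCurves.Sprung2012.Honda

end Part3

/-!
## Part 4 — port of `Summits/BirchSwinnertonDyer/Rank1Residual/Additive/PadicLayerTransport.lean` (32 declarations kept)

# Transport between points over the layer field `K_m = ℚ_p(ζ_{p^m})` (complete; where the
# logarithm `Λ` of `E₁` lives) and points over `ℚ̄_p` (where the Galois group acts): the embedding
# `toOmega`, its image (points with coordinates in the layer), kernel ↔ kernel, the `Ω`-valued
# logarithm `ΛΩ(Q) = log_E(z(Q))` with **Galois equivariance** `ΛΩ(σQ) = σΛΩ(Q)`, additivity and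
# "kernel = p-power torsion" on `E₁(K_m)`

(Port of the declarations listed in the Part header; the source module's docstring — cell bookkeeping of the BSD
printed-inputs programme — is abridged to its title here.)
-/

section Part4

open scoped _root_.Classical _root_.Topology _root_.NNReal
open _root_.Filter _root_.PowerSeries

namespace Literature.NumberTheory.EllipticCurves.Sprung2012.Honda

namespace BallEval

open Literature.NumberTheory.GaloisRepresentations.LubinTate (unitBall mem_unitBall_iff)
open Literature.NumberTheory.EllipticCurves Literature.NumberTheory.EllipticCurves.FormalGroupChart
open _root_.WeierstrassCurve PadicCyclotomicTower

/-- **The layer field `K_m = ℚ_p(ζ_{p^m})` as a type** (a synonym of `↥(layer p m)` carrying only the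
normed-field structure, so that its points use the classical decidable equality of the generic theory).
[cite: Kobayashi2003, §8.4] -/
def LayerField (p : ℕ) [Fact p.Prime] (m : ℕ) : Type := ↥(layer p m)

namespace LayerField

variable (p : ℕ) [hp : Fact p.Prime] (m : ℕ)

/-- The normed field structure of `K_m` (induced from `Ω`). [cite: Kobayashi2003, §8.4] -/
instance instNontriviallyNormedField : NontriviallyNormedField (LayerField p m) :=
  inferInstanceAs (NontriviallyNormedField ↥(layer p m))

/-- `K_m` is a normed `ℚ_p`-algebra. [cite: Kobayashi2003, §8.4] -/
instance instNormedAlgebra : NormedAlgebra ℚ_[p] (LayerField p m) :=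
  inferInstanceAs (NormedAlgebra ℚ_[p] ↥(layer p m))

/-- `K_m` is ultrametric. [cite: Kobayashi2003, §8.4] -/
instance instIsUltrametricDist : IsUltrametricDist (LayerField p m) :=
  inferInstanceAs (IsUltrametricDist ↥(layer p m))

/-- `K_m` is complete (finite over `ℚ_p`). [cite: Kobayashi2003, §8.4] -/
instance instCompleteSpace : CompleteSpace (LayerField p m) := by
  haveI := finiteDimensional_layer p m
  exact (FiniteDimensional.complete ℚ_[p] ↥(layer p m) : CompleteSpace ↥(layer p m))

/-- The inclusion `K_m → Ω` as a `ℚ_p`-algebra map. [cite: Kobayashi2003, §8.4] -/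
def emb : LayerField p m →ₐ[ℚ_[p]] PadicAlgCl p := IntermediateField.val (layer p m)

/-- An element of `Ω` lying in the layer, as an element of `K_m`. [cite: Kobayashi2003, §8.4] -/
def mk (x : PadicAlgCl p) (hx : x ∈ layer p m) : LayerField p m := (⟨x, hx⟩ : ↥(layer p m))

variable {p m}

/-- `emb (mk x) = x`. [cite: Kobayashi2003, §8.4] -/
@[simp] theorem emb_mk (x : PadicAlgCl p) (hx : x ∈ layer p m) : emb p m (mk p m x hx) = x := rfl

/-- `emb x ∈ layer p m`. [cite: Kobayashi2003, §8.4] -/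
theorem emb_mem (x : LayerField p m) : emb p m x ∈ layer p m := (show ↥(layer p m) from x).2

/-- `‖emb x‖ = ‖x‖`. [cite: Kobayashi2003, §8.4] -/
theorem norm_emb (x : LayerField p m) : ‖emb p m x‖ = ‖x‖ := rfl

/-- `emb` is injective. [cite: Kobayashi2003, §8.4] -/
theorem emb_injective : Function.Injective (emb p m) := (IntermediateField.val (layer p m)).toRingHom.injective

/-- `emb` is continuous. [cite: Kobayashi2003, §8.4] -/
theorem continuous_emb : Continuous (emb p m) := continuous_subtype_val

end LayerField

variable (p : ℕ) [hp : Fact p.Prime] (M : WeierstrassCurve ℤ_[p]) (m : ℕ)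

/-! ## §1 The layer field and the embedding of points -/

/-- `W₀ ⊗ Ω` (`W₀ = M ⊗ ℚ_p`) has `v`-integral coefficients. [cite: Kobayashi2003, §8.4] -/
theorem isIntegral_genFib_baseChange :
    ((M.map (PadicInt.Coe.ringHom (p := p))).baseChange (PadicAlgCl p)).IsIntegral
      (Valued.v (R := PadicAlgCl p)).integer := by
  have h : ∀ c : ℤ_[p], Valued.v (algebraMap ℚ_[p] (PadicAlgCl p) (c : ℚ_[p])) ≤ 1 := fun c => by
    rw [v_le_iff_norm_le, NNReal.coe_one, norm_algebraMap']; exact PadicInt.norm_le_one c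
  exact isIntegral_of_exists_lift _ ⟨⟨_, h M.a₁⟩, rfl⟩ ⟨⟨_, h M.a₂⟩, rfl⟩ ⟨⟨_, h M.a₃⟩, rfl⟩ ⟨⟨_, h M.a₄⟩, rfl⟩
    ⟨⟨_, h M.a₆⟩, rfl⟩

/-- **The embedding of `K_m`-points into `Ω`-points** (Mathlib `Point.map` of the inclusion).
[cite: SilvermanAEC2009, VII.2.2] -/
def toOmega : (curveK p (LayerField p m) M).toAffine.Point →+
    ((M.map (PadicInt.Coe.ringHom (p := p))).baseChange (PadicAlgCl p)).toAffine.Point :=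
  Affine.Point.map (W' := M.map (PadicInt.Coe.ringHom (p := p))) (LayerField.emb p m)

variable {p M m}

/-- Nonsingularity transfers along the inclusion `K_m ⊂ Ω`. [cite: Kobayashi2003, §8.4] -/
theorem nonsingular_emb {x y : LayerField p m} (h : (curveK p (LayerField p m) M).toAffine.Nonsingular x y) :
    ((M.map (PadicInt.Coe.ringHom (p := p))).baseChange (PadicAlgCl p)).toAffine.Nonsingular
      (LayerField.emb p m x) (LayerField.emb p m y) :=
  (Affine.baseChange_nonsingular (W := (M.map (PadicInt.Coe.ringHom (p := p))).toAffine)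
    (f := LayerField.emb p m) LayerField.emb_injective x y).mpr h

/-- `toOmega` on an affine point. [cite: Kobayashi2003, §8.4] -/
theorem toOmega_some {x y : LayerField p m} (h : (curveK p (LayerField p m) M).toAffine.Nonsingular x y) :
    toOmega p M m (.some x y h) = .some (LayerField.emb p m x) (LayerField.emb p m y) (nonsingular_emb h) := rfl

/-- `z(toOmega P) = z(P)`. [cite: Kobayashi2003, §8.4] -/
theorem zCoord_toOmega (P : (curveK p (LayerField p m) M).toAffine.Point) :
    (toOmega p M m P).zCoord = LayerField.emb p m P.zCoord := by
  rcases P with _ | ⟨x, y, h⟩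
  · change (0 : ((M.map (PadicInt.Coe.ringHom (p := p))).baseChange (PadicAlgCl p)).toAffine.Point).zCoord =
      LayerField.emb p m (0 : (curveK p (LayerField p m) M).toAffine.Point).zCoord
    rw [Affine.Point.zCoord_zero, Affine.Point.zCoord_zero, map_zero]
  · rw [toOmega_some, Affine.Point.zCoord_some, Affine.Point.zCoord_some, map_div₀, map_neg]

/-- The coefficients of `W₀ ⊗ Ω` lie in every layer (they lie in `ℚ_p`). [cite: Kobayashi2003, §8.4] -/
theorem coeffs_mem_layer :
    ((M.map (PadicInt.Coe.ringHom (p := p))).baseChange (PadicAlgCl p)).a₁ ∈ (layer p m).toSubfield ∧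
    ((M.map (PadicInt.Coe.ringHom (p := p))).baseChange (PadicAlgCl p)).a₂ ∈ (layer p m).toSubfield ∧
    ((M.map (PadicInt.Coe.ringHom (p := p))).baseChange (PadicAlgCl p)).a₃ ∈ (layer p m).toSubfield ∧
    ((M.map (PadicInt.Coe.ringHom (p := p))).baseChange (PadicAlgCl p)).a₄ ∈ (layer p m).toSubfield ∧
    ((M.map (PadicInt.Coe.ringHom (p := p))).baseChange (PadicAlgCl p)).a₆ ∈ (layer p m).toSubfield := by
  simp only [baseChange, map_a₁, map_a₂, map_a₃, map_a₄, map_a₆]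
  exact ⟨IntermediateField.algebraMap_mem _ _, IntermediateField.algebraMap_mem _ _, IntermediateField.algebraMap_mem _ _,
    IntermediateField.algebraMap_mem _ _, IntermediateField.algebraMap_mem _ _⟩

/-- The image of `toOmega` consists of points with coordinates in the layer. [cite: Kobayashi2003, §8.4] -/
theorem toOmega_mem_subfieldPoints (P : (curveK p (LayerField p m) M).toAffine.Point) :
    toOmega p M m P ∈ subfieldPoints ((M.map (PadicInt.Coe.ringHom (p := p))).baseChange (PadicAlgCl p)) (layer p m).toSubfield coeffs_mem_layer := by
  rcases P with _ | ⟨x, y, h⟩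
  · exact (subfieldPoints _ _ coeffs_mem_layer).zero_mem
  · rw [toOmega_some, some_mem_subfieldPoints_iff]
    exact ⟨LayerField.emb_mem x, LayerField.emb_mem y⟩

/-- **Every `Ω`-point with coordinates in the layer is in the image of `toOmega`.** [cite: Kobayashi2003, §8.4] -/
theorem exists_toOmega_eq {Q : ((M.map (PadicInt.Coe.ringHom (p := p))).baseChange (PadicAlgCl p)).toAffine.Point}
    (hQ : Q ∈ subfieldPoints ((M.map (PadicInt.Coe.ringHom (p := p))).baseChange (PadicAlgCl p)) (layer p m).toSubfield coeffs_mem_layer) :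
    ∃ P : (curveK p (LayerField p m) M).toAffine.Point, toOmega p M m P = Q := by
  rcases Q with _ | ⟨x, y, h⟩
  · exact ⟨0, rfl⟩
  · obtain ⟨hx, hy⟩ := (some_mem_subfieldPoints_iff _ h).mp hQ
    have h' : (curveK p (LayerField p m) M).toAffine.Nonsingular (LayerField.mk p m x hx) (LayerField.mk p m y hy) :=
      (Affine.baseChange_nonsingular (W := (M.map (PadicInt.Coe.ringHom (p := p))).toAffine)
        (f := LayerField.emb p m) LayerField.emb_injective (LayerField.mk p m x hx) (LayerField.mk p m y hy)).mp h
    exact ⟨.some _ _ h', rfl⟩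

variable [hintΩ : ((M.map (PadicInt.Coe.ringHom (p := p))).baseChange (PadicAlgCl p)).IsIntegral
    (Valued.v (R := PadicAlgCl p)).integer]
  [hint : (curveK p (LayerField p m) M).IsIntegral (NormedField.valuation (K := (LayerField p m))).integer]

/-- **Kernel ↔ kernel**: `toOmega P ∈ E₁(Ω) ↔ P ∈ E₁(K_m)`. [cite: Kobayashi2003, §8.4] -/
theorem toOmega_mem_kernel_iff (P : (curveK p (LayerField p m) M).toAffine.Point) :
    toOmega p M m P ∈ kernel (Valued.v (R := PadicAlgCl p)) ((M.map (PadicInt.Coe.ringHom (p := p))).baseChange (PadicAlgCl p)) ↔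
      P ∈ kernel (NormedField.valuation (K := (LayerField p m))) (curveK p (LayerField p m) M) := by
  rcases P with _ | ⟨x, y, h⟩
  · exact ⟨fun _ => (kernel (NormedField.valuation (K := (LayerField p m))) (curveK p (LayerField p m) M)).zero_mem,
      fun _ => (kernel (Valued.v (R := PadicAlgCl p))
        ((M.map (PadicInt.Coe.ringHom (p := p))).baseChange (PadicAlgCl p))).zero_mem⟩
  · rw [toOmega_some, some_mem_kernel_iff, some_mem_kernel_iff, v_lt_iff_norm_lt' , ← NNReal.coe_lt_coe,
      NormedField.valuation_apply, coe_nnnorm, NNReal.coe_one, LayerField.norm_emb]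
where
  /-- `1 < v x ↔ 1 < ‖x‖` in `Ω`. [folklore] -/
  v_lt_iff_norm_lt' {x : PadicAlgCl p} : (1 : ℝ≥0) < Valued.v x ↔ (1 : ℝ) < ‖x‖ := by
    rw [PadicAlgCl.valuation_def, ← NNReal.coe_lt_coe, coe_nnnorm, NNReal.coe_one]

/-! ## §2 The `Ω`-valued logarithm and Galois equivariance -/

variable (p M) in
/-- **`bLogΩ t = ∑ₙ logₙ tⁿ ∈ Ω`** (the same series as `bLog`, summed in `Ω`). [cite: Kobayashi2003, §8.4] -/
def bLogΩ (t : PadicAlgCl p) : PadicAlgCl p :=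
  ∑' n : ℕ, algebraMap ℚ_[p] (PadicAlgCl p) (coeff n (logQ p M)) * t ^ n

omit hintΩ hint in
/-- `bLog` on the layer, viewed in `Ω`, is `bLogΩ`. [cite: Kobayashi2003, §8.4] -/
theorem emb_bLog {t : LayerField p m} (ht : ‖t‖ < 1) :
    LayerField.emb p m (bLog p (LayerField p m) M t) = bLogΩ p M (LayerField.emb p m t) := by
  have h := (hasSum_qEval (K := LayerField p m) (norm_coeff_logQ_le (p := p) (M := M)) ht).map
    (LayerField.emb p m) LayerField.continuous_emb
  have e : ((LayerField.emb p m) ∘ fun n : ℕ =>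
      algebraMap ℚ_[p] (LayerField p m) (coeff n (logQ p M)) * t ^ n) =
      fun n : ℕ => algebraMap ℚ_[p] (PadicAlgCl p) (coeff n (logQ p M)) * (LayerField.emb p m t) ^ n := by
    funext n
    simp only [Function.comp_apply, map_mul, map_pow, AlgHom.commutes]
  have h' := e ▸ h
  rw [bLogΩ, h'.tsum_eq]
  rfl

omit hintΩ hint in
/-- **`bLogΩ (σ t) = σ (bLogΩ t)`** for `‖t‖ < 1` (coefficients in `ℚ_p`, `σ` continuous). [cite: Kobayashi2003, §8.4] -/
theorem bLogΩ_algEquiv (σ : PadicAlgCl p ≃ₐ[ℚ_[p]] PadicAlgCl p) {t : PadicAlgCl p} (ht : ‖t‖ < 1) :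
    bLogΩ p M (σ t) = σ (bLogΩ p M t) := by
  -- summability in `Ω` via the complete subfield `ℚ_p(t)`
  set F : IntermediateField ℚ_[p] (PadicAlgCl p) := IntermediateField.adjoin ℚ_[p] {t} with hF
  haveI : FiniteDimensional ℚ_[p] F := IntermediateField.adjoin.finiteDimensional (Algebra.IsIntegral.isIntegral t)
  haveI : CompleteSpace F := FiniteDimensional.complete ℚ_[p] F
  have htF : t ∈ F := IntermediateField.mem_adjoin_simple_self ℚ_[p] t
  set t' : F := ⟨t, htF⟩
  have ht' : ‖t'‖ < 1 := ht
  have hs : HasSum (fun n : ℕ => algebraMap ℚ_[p] (PadicAlgCl p) (coeff n (logQ p M)) * t ^ n) (bLogΩ p M t) := by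
    have h := (hasSum_qEval (K := ↥F) (norm_coeff_logQ_le (p := p) (M := M)) ht').map
      (IntermediateField.val F) continuous_subtype_val
    have e : ((IntermediateField.val F) ∘ fun n : ℕ => algebraMap ℚ_[p] (↥F) (coeff n (logQ p M)) * t' ^ n) =
        fun n : ℕ => algebraMap ℚ_[p] (PadicAlgCl p) (coeff n (logQ p M)) * t ^ n := by
      funext n
      simp only [Function.comp_apply, map_mul, map_pow, AlgHom.commutes]
      rfl
    have h' := e ▸ h
    rw [bLogΩ, h'.tsum_eq]; exact h'
  -- `σ` is an isometry (Mathlib `spectralNorm_eq_of_equiv`), hence continuous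
  have hσc : Continuous σ := by
    refine AddMonoidHomClass.continuous_of_bound σ 1 fun x => ?_
    rw [one_mul, ← PadicAlgCl.spectralNorm_eq, ← PadicAlgCl.spectralNorm_eq]
    exact (spectralNorm_eq_of_equiv σ x).symm.le
  have h2 := hs.map σ hσc
  have e2 : (σ : PadicAlgCl p → PadicAlgCl p) ∘ (fun n : ℕ => algebraMap ℚ_[p] (PadicAlgCl p) (coeff n (logQ p M)) * t ^ n) =
      fun n : ℕ => algebraMap ℚ_[p] (PadicAlgCl p) (coeff n (logQ p M)) * (σ t) ^ n := by
    funext n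
    simp only [Function.comp_apply, map_mul, map_pow, AlgEquiv.commutes]
  rw [e2] at h2
  rw [bLogΩ, h2.tsum_eq]

variable (p M) in
/-- **`ΛΩ(Q) = log_E(z(Q)) ∈ Ω`**, the logarithm read on `Ω`-points. [cite: Kobayashi2003, §8.4] -/
def ptLogΩ (Q : ((M.map (PadicInt.Coe.ringHom (p := p))).baseChange (PadicAlgCl p)).toAffine.Point) : PadicAlgCl p :=
  bLogΩ p M Q.zCoord

omit hintΩ in
/-- `ΛΩ(toOmega P) = Λ(P)` for `P ∈ E₁(K_m)`. [cite: Kobayashi2003, §8.4] -/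
theorem ptLogΩ_toOmega {P : (curveK p (LayerField p m) M).toAffine.Point}
    (hP : P ∈ kernel (NormedField.valuation (K := LayerField p m)) (curveK p (LayerField p m) M)) :
    ptLogΩ p M (toOmega p M m P) = LayerField.emb p m (ptLog p (LayerField p m) M P) := by
  rw [ptLogΩ, zCoord_toOmega, ptLog, emb_bLog (norm_zCoord_lt_one hP)]

variable [hE : (M.map PadicInt.Coe.ringHom).IsElliptic]

/-- **Additivity of `ΛΩ` on `E₁(Ω)`-points with coordinates in the layer.** [cite: SilvermanAEC2009, IV.6.4] -/
theorem ptLogΩ_add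
    {Q₁ Q₂ : ((M.map (PadicInt.Coe.ringHom (p := p))).baseChange (PadicAlgCl p)).toAffine.Point}
    (h₁ : Q₁ ∈ subfieldPoints ((M.map (PadicInt.Coe.ringHom (p := p))).baseChange (PadicAlgCl p)) (layer p m).toSubfield coeffs_mem_layer)
    (h₂ : Q₂ ∈ subfieldPoints ((M.map (PadicInt.Coe.ringHom (p := p))).baseChange (PadicAlgCl p)) (layer p m).toSubfield coeffs_mem_layer)
    (hk₁ : Q₁ ∈ kernel (Valued.v (R := PadicAlgCl p)) ((M.map (PadicInt.Coe.ringHom (p := p))).baseChange (PadicAlgCl p)))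
    (hk₂ : Q₂ ∈ kernel (Valued.v (R := PadicAlgCl p)) ((M.map (PadicInt.Coe.ringHom (p := p))).baseChange (PadicAlgCl p))) :
    ptLogΩ p M (Q₁ + Q₂) = ptLogΩ p M Q₁ + ptLogΩ p M Q₂ := by
  obtain ⟨P₁, rfl⟩ := exists_toOmega_eq h₁
  obtain ⟨P₂, rfl⟩ := exists_toOmega_eq h₂
  have hP₁ : P₁ ∈ kernel (NormedField.valuation (K := (LayerField p m))) (curveK p (LayerField p m) M) :=
    (toOmega_mem_kernel_iff P₁).mp hk₁
  have hP₂ : P₂ ∈ kernel (NormedField.valuation (K := (LayerField p m))) (curveK p (LayerField p m) M) :=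
    (toOmega_mem_kernel_iff P₂).mp hk₂
  rw [← map_add, ptLogΩ_toOmega hP₁, ptLogΩ_toOmega hP₂,
    ptLogΩ_toOmega ((kernel (NormedField.valuation (K := LayerField p m)) (curveK p (LayerField p m) M)).add_mem hP₁ hP₂),
    ptLog_add hP₁ hP₂, map_add]

/-- **`ΛΩ(Q) = 0 ⇒ p^k • Q = 0`** for `Q ∈ E₁(Ω)` with coordinates in the layer. [cite: SilvermanAEC2009, IV.6.4] -/
theorem exists_pow_smul_eq_zero_of_ptLogΩ_eq_zero
    {Q : ((M.map (PadicInt.Coe.ringHom (p := p))).baseChange (PadicAlgCl p)).toAffine.Point}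
    (hQ : Q ∈ subfieldPoints ((M.map (PadicInt.Coe.ringHom (p := p))).baseChange (PadicAlgCl p)) (layer p m).toSubfield coeffs_mem_layer)
    (hk : Q ∈ kernel (Valued.v (R := PadicAlgCl p)) ((M.map (PadicInt.Coe.ringHom (p := p))).baseChange (PadicAlgCl p)))
    (h0 : ptLogΩ p M Q = 0) : ∃ k : ℕ, p ^ k • Q = 0 := by
  obtain ⟨P, rfl⟩ := exists_toOmega_eq hQ
  have hP : P ∈ kernel (NormedField.valuation (K := (LayerField p m))) (curveK p (LayerField p m) M) :=
    (toOmega_mem_kernel_iff P).mp hk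
  rw [ptLogΩ_toOmega hP, map_eq_zero_iff _ LayerField.emb_injective] at h0
  have h0' : ptLog p (LayerField p m) M P = 0 := h0
  obtain ⟨k, hk'⟩ := exists_pow_smul_eq_zero_of_ptLog_eq_zero hP h0'
  exact ⟨k, by rw [← map_nsmul, hk', map_zero]⟩

end BallEval

end Literature.NumberTheory.EllipticCurves.Sprung2012.Honda

end Part4

/-!
## Part 5 — port of `Summits/BirchSwinnertonDyer/Rank1Residual/Additive/KobayashiLogFss.lean` (13 declarations kept)

# Kobayashi's supersingular logarithm `log_{F_ss}(X) = ∑ₖ (−1)ᵏ ((1+X)^{p^{2k}} − 1)/pᵏ ∈ ℚ_p⟦X⟧`: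
# definition (coefficients as convergent `p`-adic series), the growth bound `‖[Xᵈ] log_{F_ss}‖ ≤ d`,
# and its HONDA TYPE `T² + p`

(Port of the declarations listed in the Part header; the source module's docstring — cell bookkeeping of the BSD
printed-inputs programme — is abridged to its title here.)
-/

section Part5

open scoped _root_.Classical _root_.Topology
open _root_.Filter _root_.PowerSeries

namespace Literature.NumberTheory.EllipticCurves.Sprung2012.Honda

namespace HondaFss

open Literature.RingTheory.FormalGroups

variable (p : ℕ) [hp : Fact p.Prime]

/-! ## §1 Binomial coefficients -/

/-- `[Xᵈ](1+X)^N = C(N, d)` in `ℚ_p⟦X⟧`. [cite: Kobayashi2003, §8.2] -/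
theorem coeff_one_add_X_pow (N d : ℕ) : coeff d ((1 + X : ℚ_[p]⟦X⟧) ^ N) = (N.choose d : ℚ_[p]) := by
  have h : ((1 + X : ℚ_[p]⟦X⟧) ^ N) = (((1 + Polynomial.X : Polynomial ℚ_[p]) ^ N : Polynomial ℚ_[p]) :
      ℚ_[p]⟦X⟧) := by
    rw [Polynomial.coe_pow, Polynomial.coe_add, Polynomial.coe_one, Polynomial.coe_X]
  rw [h, Polynomial.coeff_coe, Polynomial.coeff_one_add_X_pow]

/-- **`‖C(pⁿ, d)‖ ≤ d · p⁻ⁿ`** (`d·C(pⁿ,d) = pⁿ·C(pⁿ−1, d−1)`; Kummer gives the exact value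
`p^{−(n − v_p(d))}`). [cite: Kobayashi2003, §8.2] -/
theorem norm_choose_prime_pow_le (n : ℕ) {d : ℕ} (hd : d ≠ 0) :
    ‖((p ^ n).choose d : ℚ_[p])‖ ≤ d * (p : ℝ)⁻¹ ^ n := by
  obtain ⟨e, rfl⟩ := Nat.exists_eq_succ_of_ne_zero hd
  rcases Nat.eq_zero_or_pos (p ^ n) with h0 | hpos
  · exact absurd h0 (pow_ne_zero n hp.out.ne_zero)
  obtain ⟨N, hN⟩ := Nat.exists_eq_succ_of_ne_zero hpos.ne'
  -- `(e+1) C(N+1, e+1) = (N+1) C(N, e)`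
  have hid : ((e + 1 : ℕ) : ℚ_[p]) * ((p ^ n).choose (e + 1) : ℚ_[p]) = (p : ℚ_[p]) ^ n * (N.choose e : ℚ_[p]) := by
    have h := Nat.add_one_mul_choose_eq N e
    have hN' : N + 1 = p ^ n := hN.symm
    rw [hN'] at h
    have h' : ((p ^ n : ℕ) : ℚ_[p]) * (N.choose e : ℚ_[p]) = ((p ^ n).choose (e + 1) : ℚ_[p]) * ((e + 1 : ℕ) : ℚ_[p]) := by
      exact_mod_cast h
    rw [Nat.cast_pow] at h'
    linear_combination -h'
  have he : ((e + 1 : ℕ) : ℚ_[p]) ≠ 0 := Nat.cast_ne_zero.mpr (Nat.succ_ne_zero e)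
  have hC : ((p ^ n).choose (e + 1) : ℚ_[p]) = ((e + 1 : ℕ) : ℚ_[p])⁻¹ * ((p : ℚ_[p]) ^ n * (N.choose e : ℚ_[p])) := by
    rw [← hid, ← mul_assoc, inv_mul_cancel₀ he, one_mul]
  rw [hC, norm_mul, norm_mul, norm_pow, Padic.norm_p]
  calc ‖((e + 1 : ℕ) : ℚ_[p])⁻¹‖ * ((p : ℝ)⁻¹ ^ n * ‖(N.choose e : ℚ_[p])‖)
      ≤ ((e + 1 : ℕ) : ℝ) * ((p : ℝ)⁻¹ ^ n * 1) := by
        refine mul_le_mul (Literature.NumberTheory.EllipticCurves.norm_inv_natCast_le (p := p) (Nat.succ_ne_zero e)) ?_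
          (by positivity) (Nat.cast_nonneg _)
        exact mul_le_mul_of_nonneg_left (by simpa using Padic.norm_int_le_one (p := p) (N.choose e : ℤ)) (by positivity)
    _ = ((e + 1 : ℕ) : ℝ) * (p : ℝ)⁻¹ ^ n := by rw [mul_one]

/-! ## §2 The series `log_{F_ss}` -/

/-- **The `Xᵈ`-coefficient of `(−1)ᵏ((1+X)^{p^{2k}} − 1)/pᵏ`**: `(−1)ᵏ (C(p^{2k}, d) − [d = 0]) / pᵏ`.
[cite: Kobayashi2003, §8.2] -/
def logFssTerm (k d : ℕ) : ℚ_[p] :=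
  (-1) ^ k * (((p ^ (2 * k)).choose d : ℚ_[p]) - if d = 0 then 1 else 0) / (p : ℚ_[p]) ^ k

/-- `logFssTerm k 0 = 0`. [cite: Kobayashi2003, §8.2] -/
theorem logFssTerm_zero (k : ℕ) : logFssTerm p k 0 = 0 := by
  simp [logFssTerm]

/-- **`‖logFssTerm k d‖ ≤ d p⁻ᵏ`.** [cite: Kobayashi2003, §8.2] -/
theorem norm_logFssTerm_le (k d : ℕ) : ‖logFssTerm p k d‖ ≤ d * (p : ℝ)⁻¹ ^ k := by
  rcases Nat.eq_zero_or_pos d with rfl | hd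
  · simp [logFssTerm_zero]
  rw [logFssTerm, if_neg hd.ne', sub_zero, norm_div, norm_mul, norm_pow, norm_neg, norm_one, one_pow, one_mul,
    norm_pow, Padic.norm_p]
  have h := norm_choose_prime_pow_le p (2 * k) hd.ne'
  have hp0 : (0 : ℝ) < p := by exact_mod_cast hp.out.pos
  rw [div_le_iff₀ (by positivity)]
  calc ‖((p ^ (2 * k)).choose d : ℚ_[p])‖ ≤ d * (p : ℝ)⁻¹ ^ (2 * k) := h
    _ = d * (p : ℝ)⁻¹ ^ k * (p : ℝ)⁻¹ ^ k := by rw [two_mul, pow_add, mul_assoc]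

/-- The terms are summable in `k` (geometric majorant). [cite: Kobayashi2003, §8.2] -/
theorem summable_logFssTerm (d : ℕ) : Summable fun k : ℕ => logFssTerm p k d := by
  refine Summable.of_norm_bounded (g := fun k : ℕ => (d : ℝ) * (p : ℝ)⁻¹ ^ k) ?_ (norm_logFssTerm_le p · d)
  have hr : (p : ℝ)⁻¹ < 1 := inv_lt_one_of_one_lt₀ (by exact_mod_cast hp.out.one_lt)
  exact (summable_geometric_of_lt_one (by positivity) hr).mul_left _

/-- **Kobayashi's `log_{F_ss}(X) = ∑ₖ (−1)ᵏ((1+X)^{p^{2k}} − 1)/pᵏ`**, as the power series whose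
`Xᵈ`-coefficient is the convergent `p`-adic sum `∑'ₖ logFssTerm k d`. [cite: Kobayashi2003, §8.2] -/
def logFss : ℚ_[p]⟦X⟧ := PowerSeries.mk fun d => ∑' k : ℕ, logFssTerm p k d

/-- The coefficients of `logFss`. [cite: Kobayashi2003, §8.2] -/
theorem coeff_logFss (d : ℕ) : coeff d (logFss p) = ∑' k : ℕ, logFssTerm p k d := by
  rw [logFss, coeff_mk]

/-- `logFss(0) = 0`. [cite: Kobayashi2003, §8.2] -/
theorem constantCoeff_logFss : constantCoeff (logFss p) = 0 := by
  rw [← coeff_zero_eq_constantCoeff, coeff_logFss]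
  simp [logFssTerm_zero]

/-- `[X¹] log_{F_ss} = ∑ₖ (−p)ᵏ` has norm `1` (its `k = 0` term is `1`, the others are in `pℤ_p`).
[cite: Kobayashi2003, §8.2] -/
theorem norm_coeff_one_logFss : ‖coeff 1 (logFss p)‖ = 1 := by
  rw [coeff_logFss]
  have hs := summable_logFssTerm p 1
  rw [hs.tsum_eq_zero_add]
  have h0 : logFssTerm p 0 1 = 1 := by simp [logFssTerm]
  have htail : ‖∑' k : ℕ, logFssTerm p (k + 1) 1‖ < 1 := by
    have hr : (p : ℝ)⁻¹ < 1 := inv_lt_one_of_one_lt₀ (by exact_mod_cast hp.out.one_lt)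
    refine (IsUltrametricDist.norm_tsum_le_of_forall_le_of_nonneg (le_of_lt (inv_pos.mpr
      (by exact_mod_cast hp.out.pos : (0:ℝ) < p))) fun k => ?_).trans_lt hr
    refine (norm_logFssTerm_le p (k + 1) 1).trans ?_
    rw [Nat.cast_one, one_mul, pow_succ]
    exact mul_le_of_le_one_left (by positivity) (pow_le_one₀ (by positivity) hr.le)
  rw [h0, IsUltrametricDist.norm_add_eq_max_of_norm_ne_norm, norm_one, max_eq_left htail.le]
  rw [norm_one]; exact (ne_of_lt htail).symm

/-! ## §3 The Honda type `T² + p` -/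

/-- **The congruence `(1+X)^{p^{2k+2}} ≡ (1+X^{p²})^{p^{2k}} (mod p^{2k+1})`**, coefficientwise.
[Hazewinkel 1978, I.2.3] [cite: Kobayashi2003, §8.2] -/
theorem norm_coeff_pow_sub_expand_pow_le (k n : ℕ) :
    ‖coeff n ((1 + X : ℚ_[p]⟦X⟧) ^ p ^ (2 * k + 2) -
      expand (p ^ 2) (prime_sq_ne_zero p) ((1 + X : ℚ_[p]⟦X⟧) ^ p ^ (2 * k)))‖ ≤ (p : ℝ)⁻¹ ^ (2 * k + 1) := by
  have hXc : ∀ m, ‖coeff m (X : ℚ_[p]⟦X⟧)‖ ≤ 1 := by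
    intro m
    rw [coeff_X]
    by_cases hm : m = 1
    · rw [if_pos hm, norm_one]
    · rw [if_neg hm, norm_zero]; exact zero_le_one
  have h1X : ∀ m, ‖coeff m (1 + X : ℚ_[p]⟦X⟧)‖ ≤ 1 := norm_coeff_add_le norm_coeff_one_le hXc
  -- `α = (1+X)^{p²}`, `β = (1+X)(X^{p²}) = 1 + X^{p²}`: `α ≡ β (mod p)`
  have hαβ := norm_coeff_pow_sq_sub_expand_le h1X
  have hβ : ∀ m, ‖coeff m (expand (p ^ 2) (prime_sq_ne_zero p) (1 + X : ℚ_[p]⟦X⟧))‖ ≤ 1 :=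
    norm_coeff_expand_le _ zero_le_one h1X
  have h := norm_coeff_pow_prime_pow_sub_le (s := 1) le_rfl hβ
    (fun m => by simpa using hαβ m) (2 * k) n
  have e1 : ((1 + X : ℚ_[p]⟦X⟧) ^ p ^ 2) ^ p ^ (2 * k) = (1 + X : ℚ_[p]⟦X⟧) ^ p ^ (2 * k + 2) := by
    rw [← pow_mul, ← pow_add, Nat.add_comm 2 (2 * k)]
  have e2 : (expand (p ^ 2) (prime_sq_ne_zero p) (1 + X : ℚ_[p]⟦X⟧)) ^ p ^ (2 * k) =
      expand (p ^ 2) (prime_sq_ne_zero p) ((1 + X : ℚ_[p]⟦X⟧) ^ p ^ (2 * k)) := by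
    rw [map_pow]
  rw [e1, e2, add_comm 1 (2 * k)] at h
  exact h

/-- The combined term `logFssTerm (k+1) n + (1/p)·[p² ∣ n]·logFssTerm k (n/p²)` is the
`Xⁿ`-coefficient of `(−1)^{k+1}((1+X)^{p^{2k+2}} − (1+X^{p²})^{p^{2k}})/p^{k+1}`, hence integral.
[cite: Kobayashi2003, §8.2] -/
theorem norm_combined_le_one (k n : ℕ) :
    ‖logFssTerm p (k + 1) n + 1 / (p : ℚ_[p]) * (if p ^ 2 ∣ n then logFssTerm p k (n / p ^ 2) else 0)‖ ≤ 1 := by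
  have hp0 : (p : ℚ_[p]) ≠ 0 := Nat.cast_ne_zero.mpr hp.out.ne_zero
  -- express as a coefficient
  set D : ℚ_[p]⟦X⟧ := (1 + X : ℚ_[p]⟦X⟧) ^ p ^ (2 * k + 2) -
      expand (p ^ 2) (prime_sq_ne_zero p) ((1 + X : ℚ_[p]⟦X⟧) ^ p ^ (2 * k)) with hD
  have hcoeff : logFssTerm p (k + 1) n + 1 / (p : ℚ_[p]) * (if p ^ 2 ∣ n then logFssTerm p k (n / p ^ 2) else 0) =
      (-1) ^ (k + 1) / (p : ℚ_[p]) ^ (k + 1) * coeff n D := by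
    rw [hD, map_sub, coeff_one_add_X_pow, coeff_expand]
    by_cases hdiv : p ^ 2 ∣ n
    · rw [if_pos hdiv, if_pos hdiv, coeff_one_add_X_pow, logFssTerm, logFssTerm]
      have hn0 : (n = 0 ↔ n / p ^ 2 = 0) := by
        obtain ⟨q, rfl⟩ := hdiv
        rw [Nat.mul_div_cancel_left _ (pos_of_gt (Nat.one_lt_pow two_ne_zero hp.out.one_lt))]
        constructor
        · intro h; exact (mul_eq_zero.mp h).resolve_left (pow_ne_zero 2 hp.out.ne_zero)
        · rintro rfl; simp
      by_cases hn : n = 0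
      · rw [if_pos hn, if_pos (hn0.mp hn)]
        rw [show 2 * (k + 1) = 2 * k + 2 by ring, pow_succ, pow_succ]
        field_simp
        ring
      · rw [if_neg hn, if_neg (mt hn0.mpr hn)]
        rw [show 2 * (k + 1) = 2 * k + 2 by ring, pow_succ, pow_succ]
        field_simp
        ring
    · rw [if_neg hdiv, if_neg hdiv, mul_zero, add_zero, sub_zero, logFssTerm]
      have hn : n ≠ 0 := by rintro rfl; exact hdiv (dvd_zero _)
      rw [if_neg hn, sub_zero, show 2 * (k + 1) = 2 * k + 2 by ring]
      ring
  rw [hcoeff, norm_mul, norm_div, norm_pow, norm_neg, norm_one, one_pow, norm_pow, Padic.norm_p, one_div]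
  have h := norm_coeff_pow_sub_expand_pow_le p k n
  rw [← hD] at h
  have hp1 : (1 : ℝ) ≤ p := by exact_mod_cast hp.out.one_lt.le
  calc ((p : ℝ)⁻¹ ^ (k + 1))⁻¹ * ‖coeff n D‖ ≤ ((p : ℝ)⁻¹ ^ (k + 1))⁻¹ * (p : ℝ)⁻¹ ^ (2 * k + 1) :=
        mul_le_mul_of_nonneg_left h (by positivity)
    _ = (p : ℝ)⁻¹ ^ k := by
        have hq : (p : ℝ)⁻¹ ^ (k + 1) ≠ 0 := pow_ne_zero _ (inv_ne_zero (by positivity))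
        rw [show 2 * k + 1 = (k + 1) + k by ring, pow_add ((p : ℝ)⁻¹) (k + 1) k, ← mul_assoc,
          inv_mul_cancel₀ hq, one_mul]
    _ ≤ 1 := pow_le_one₀ (by positivity) (inv_le_one_of_one_le₀ hp1)

/-- **`log_{F_ss}` is of Honda type `T² + p`**: `hondaShift p 0 log_{F_ss} ∈ ℤ_p⟦X⟧`.
[cite: Kobayashi2003, §8.2] -/
theorem norm_coeff_hondaShift_logFss_le_one (n : ℕ) : ‖coeff n (hondaShift p 0 (logFss p))‖ ≤ 1 := by
  rw [coeff_hondaShift, zero_div, zero_mul, sub_zero, coeff_logFss]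
  have hs := summable_logFssTerm p n
  -- the second summand as a tsum over `k`
  have h2 : 1 / (p : ℚ_[p]) * (if p ^ 2 ∣ n then coeff (n / p ^ 2) (logFss p) else 0) =
      ∑' k : ℕ, 1 / (p : ℚ_[p]) * (if p ^ 2 ∣ n then logFssTerm p k (n / p ^ 2) else 0) := by
    split_ifs with h
    · rw [coeff_logFss, ← tsum_mul_left]
    · simp
  have hs2 : Summable fun k : ℕ => 1 / (p : ℚ_[p]) * (if p ^ 2 ∣ n then logFssTerm p k (n / p ^ 2) else 0) := by
    split_ifs
    · exact (summable_logFssTerm p _).mul_left _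
    · simp
  rw [h2, hs.tsum_eq_zero_add, add_assoc, ← (((summable_nat_add_iff 1).mpr hs)).tsum_add hs2]
  -- `k = 0` term: `C(1, n) − [n = 0]` is `[n = 1]`
  have h0 : ‖logFssTerm p 0 n‖ ≤ 1 := by
    have e : logFssTerm p 0 n = ((Nat.choose 1 n : ℕ) : ℚ_[p]) - if n = 0 then 1 else 0 := by
      simp [logFssTerm]
    rw [e]
    rcases n with _ | _ | n
    · simp
    · simp
    · rw [if_neg (by omega), sub_zero, Nat.choose_eq_zero_of_lt (by omega)]; simp
  refine (IsUltrametricDist.norm_add_le_max _ _).trans (max_le h0 ?_)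
  exact IsUltrametricDist.norm_tsum_le_of_forall_le_of_nonneg zero_le_one fun k => norm_combined_le_one p k n

end HondaFss

end Literature.NumberTheory.EllipticCurves.Sprung2012.Honda

end Part5

/-!
## Part 6 — port of `Summits/BirchSwinnertonDyer/Rank1Residual/Additive/KobayashiHondaIso.lean` (22 declarations kept)

# Honda's isomorphism `i = exp_E ∘ log_{F_ss} ∈ Xℤ_p⟦X⟧` between Kobayashi's formal group `F_ss`
# and the formal group of a good supersingular `a_p = 0` model `M/ℤ_p` (`p` odd), its inverse
# `j = exp_{F_ss} ∘ log_E ∈ Xℤ_p⟦X⟧`, and the identities `log_E ∘ i = log_{F_ss}`, `i ∘ j = j ∘ i = X`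
#

(Port of the declarations listed in the Part header; the source module's docstring — cell bookkeeping of the BSD
printed-inputs programme — is abridged to its title here.)
-/

section Part6

open scoped _root_.Classical
open _root_.PowerSeries

namespace Literature.NumberTheory.EllipticCurves.Sprung2012.Honda

namespace HondaFss

open Literature.RingTheory.FormalGroups _root_.WeierstrassCurve

variable (p : ℕ) [hp : Fact p.Prime] (M : WeierstrassCurve ℤ_[p])

/-! ## §1 `ψ = exp_E ∘ log_{F_ss}` and its inverse -/

/-- **`ψ = exp_E ∘ log_{F_ss} ∈ ℚ_p⟦X⟧`** (`E = M ⊗ ℚ_p`). [cite: Kobayashi2003, Prop. 8.4] -/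
def hondaPsi : ℚ_[p]⟦X⟧ := (M.map (PadicInt.Coe.ringHom (p := p))).formalExp.subst (logFss p)

/-- `HasSubst log_{F_ss}`. [cite: Kobayashi2003, Prop. 8.4] -/
theorem hasSubst_logFss : HasSubst (logFss p) := HasSubst.of_constantCoeff_zero' (constantCoeff_logFss p)

/-- `ψ(0) = 0`. [cite: Kobayashi2003, Prop. 8.4] -/
theorem constantCoeff_hondaPsi : constantCoeff (hondaPsi p M) = 0 := by
  rw [hondaPsi, constantCoeff_subst_of_constantCoeff_eq_zero (constantCoeff_logFss p),
    (M.map PadicInt.Coe.ringHom).constantCoeff_formalExp]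

/-- `HasSubst ψ`. [cite: Kobayashi2003, Prop. 8.4] -/
theorem hasSubst_hondaPsi : HasSubst (hondaPsi p M) := HasSubst.of_constantCoeff_zero' (constantCoeff_hondaPsi p M)

/-- `HasSubst exp_E`. [cite: Kobayashi2003, Prop. 8.4] -/
theorem hasSubst_formalExp' : HasSubst (M.map (PadicInt.Coe.ringHom (p := p))).formalExp :=
  HasSubst.of_constantCoeff_zero' (M.map PadicInt.Coe.ringHom).constantCoeff_formalExp

/-- **`log_E ∘ ψ = log_{F_ss}`** (`log_E ∘ exp_E = X`). [cite: Kobayashi2003, Prop. 8.4] -/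
theorem formalLog_subst_hondaPsi :
    (M.map (PadicInt.Coe.ringHom (p := p))).formalLog.subst (hondaPsi p M) = logFss p := by
  rw [hondaPsi, ← PowerSeries.subst_comp_subst_apply (hasSubst_formalExp' p M) (hasSubst_logFss p),
    (M.map PadicInt.Coe.ringHom).formalLog_subst_formalExp, PowerSeries.subst_X (hasSubst_logFss p)]

/-- `[X¹]ψ = [X¹]log_{F_ss}` is a unit. [cite: Kobayashi2003, Prop. 8.4] -/
theorem isUnit_coeff_one_hondaPsi : IsUnit (coeff 1 (hondaPsi p M)) := by
  -- from `log_E ∘ ψ = log_{F_ss}`: `[X¹](log_E ∘ ψ) = log₀·[X¹]ψ⁰ + log₁ · [X¹]ψ = [X¹]ψ`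
  have h := congrArg (coeff 1) (formalLog_subst_hondaPsi p M)
  rw [coeff_subst_eq_sum (constantCoeff_hondaPsi p M), Finset.sum_range_succ, Finset.sum_range_succ,
    Finset.sum_range_zero, zero_add, PowerSeries.coeff_zero_eq_constantCoeff,
    (M.map PadicInt.Coe.ringHom).constantCoeff_formalLog, zero_mul, zero_add,
    (M.map PadicInt.Coe.ringHom).coeff_one_formalLog, one_mul, pow_one] at h
  rw [h, isUnit_iff_ne_zero, ← norm_pos_iff, norm_coeff_one_logFss]
  exact one_pos

/-- **`ψ⁻¹`**, the compositional inverse of `ψ` (`= exp_{F_ss} ∘ log_E`). [cite: Kobayashi2003, Prop. 8.4] -/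
def hondaPsiInv : ℚ_[p]⟦X⟧ := PowerSeries.substInvOfIsUnit (hondaPsi p M) (isUnit_coeff_one_hondaPsi p M)

/-- `ψ⁻¹(0) = 0`. [cite: Kobayashi2003, Prop. 8.4] -/
theorem constantCoeff_hondaPsiInv : constantCoeff (hondaPsiInv p M) = 0 :=
  PowerSeries.constantCoeff_substInvOfIsUnit _ _

/-- `HasSubst ψ⁻¹`. [cite: Kobayashi2003, Prop. 8.4] -/
theorem hasSubst_hondaPsiInv : HasSubst (hondaPsiInv p M) := PowerSeries.HasSubst.substInvOfIsUnit _ _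

/-- `ψ ∘ ψ⁻¹ = X`. [cite: Kobayashi2003, Prop. 8.4] -/
theorem hondaPsi_subst_hondaPsiInv : (hondaPsi p M).subst (hondaPsiInv p M) = X :=
  PowerSeries.subst_substInvOfIsUnit_right _ (constantCoeff_hondaPsi p M) _

/-- **`log_{F_ss} ∘ ψ⁻¹ = log_E`.** [cite: Kobayashi2003, Prop. 8.4] -/
theorem logFss_subst_hondaPsiInv :
    (logFss p).subst (hondaPsiInv p M) = (M.map (PadicInt.Coe.ringHom (p := p))).formalLog := by
  rw [← formalLog_subst_hondaPsi p M, PowerSeries.subst_comp_subst_apply (hasSubst_hondaPsi p M)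
    (hasSubst_hondaPsiInv p M), hondaPsi_subst_hondaPsiInv, PowerSeries.X_subst]

/-! ## §2 Integrality (Honda) for a good supersingular `a_p = 0` model, `p` odd -/

variable [hE : (M.map PadicInt.Coe.ringHom).IsElliptic] [hEt : (M.map PadicInt.toZMod).IsElliptic]

/-- `log_E` is of Honda type `T² + p` when `a_p(M) = 0` (the tree's Honda congruences, `p` odd).
[cite: Kobayashi2003, Prop. 8.4] -/
theorem norm_coeff_hondaShift_formalLog_le_one_of_tr_eq_zero (hp2 : p ≠ 2)
    (htr : Literature.NumberTheory.EllipticCurves.HasseManin.tr (M.map PadicInt.toZMod) = 0) (n : ℕ) :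
    ‖coeff n (hondaShift p 0 (M.map (PadicInt.Coe.ringHom (p := p))).formalLog)‖ ≤ 1 := by
  have h := M.norm_coeff_hondaShift_formalLog_le_one hp2 n
  rwa [htr, Int.cast_zero] at h

/-- **`ψ = exp_E ∘ log_{F_ss} ∈ ℤ_p⟦X⟧`** (Honda: two logarithms of the same type `T² + p`).
[cite: Kobayashi2003, Prop. 8.4] -/
theorem norm_coeff_hondaPsi_le_one (hp2 : p ≠ 2)
    (htr : Literature.NumberTheory.EllipticCurves.HasseManin.tr (M.map PadicInt.toZMod) = 0) (n : ℕ) :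
    ‖coeff n (hondaPsi p M)‖ ≤ 1 := by
  refine norm_coeff_le_one_of_subst_eq (p := p) (a := 0) (by simp)
    (norm_coeff_hondaShift_formalLog_le_one_of_tr_eq_zero p M hp2 htr) (norm_coeff_hondaShift_logFss_le_one p)
    ?_ (constantCoeff_hondaPsi p M) (formalLog_subst_hondaPsi p M) n
  rw [(M.map PadicInt.Coe.ringHom).coeff_one_formalLog, norm_one]

/-- **`ψ⁻¹ = exp_{F_ss} ∘ log_E ∈ ℤ_p⟦X⟧`** (Honda, roles exchanged). [cite: Kobayashi2003, Prop. 8.4] -/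
theorem norm_coeff_hondaPsiInv_le_one (hp2 : p ≠ 2)
    (htr : Literature.NumberTheory.EllipticCurves.HasseManin.tr (M.map PadicInt.toZMod) = 0) (n : ℕ) :
    ‖coeff n (hondaPsiInv p M)‖ ≤ 1 :=
  norm_coeff_le_one_of_subst_eq (p := p) (a := 0) (by simp) (norm_coeff_hondaShift_logFss_le_one p)
    (norm_coeff_hondaShift_formalLog_le_one_of_tr_eq_zero p M hp2 htr) (norm_coeff_one_logFss p)
    (constantCoeff_hondaPsiInv p M) (logFss_subst_hondaPsiInv p M) n

/-- **Honda's isomorphism `i : F_ss → Ê` as an integral series** (`ψ` lifted to `ℤ_p⟦X⟧`).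
[cite: Kobayashi2003, Prop. 8.4] -/
def hondaIso (hp2 : p ≠ 2)
    (htr : Literature.NumberTheory.EllipticCurves.HasseManin.tr (M.map PadicInt.toZMod) = 0) : ℤ_[p]⟦X⟧ :=
  liftInt (hondaPsi p M) (norm_coeff_hondaPsi_le_one p M hp2 htr)

/-- **The inverse isomorphism `j : Ê → F_ss`** as an integral series. [cite: Kobayashi2003, Prop. 8.4] -/
def hondaIsoInv (hp2 : p ≠ 2)
    (htr : Literature.NumberTheory.EllipticCurves.HasseManin.tr (M.map PadicInt.toZMod) = 0) : ℤ_[p]⟦X⟧ :=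
  liftInt (hondaPsiInv p M) (norm_coeff_hondaPsiInv_le_one p M hp2 htr)

variable {p M}
variable (hp2 : p ≠ 2) (htr : Literature.NumberTheory.EllipticCurves.HasseManin.tr (M.map PadicInt.toZMod) = 0)

/-- `hondaIso ⊗ ℚ_p = ψ`. [cite: Kobayashi2003, Prop. 8.4] -/
theorem map_hondaIso : (hondaIso p M hp2 htr).map PadicInt.Coe.ringHom = hondaPsi p M := map_liftInt _ _

/-- `hondaIsoInv ⊗ ℚ_p = ψ⁻¹`. [cite: Kobayashi2003, Prop. 8.4] -/
theorem map_hondaIsoInv : (hondaIsoInv p M hp2 htr).map PadicInt.Coe.ringHom = hondaPsiInv p M := map_liftInt _ _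

/-- `PowerSeries.map` along `ℤ_p → ℚ_p` is injective. [cite: Kobayashi2003, Prop. 8.4] -/
theorem map_injective : Function.Injective (PowerSeries.map (PadicInt.Coe.ringHom (p := p))) := by
  intro f g h
  ext n
  have := congrArg (coeff n) h
  rw [coeff_map, coeff_map] at this
  exact Subtype.ext this

/-- `j(0) = 0`. [cite: Kobayashi2003, Prop. 8.4] -/
theorem constantCoeff_hondaIsoInv : constantCoeff (hondaIsoInv p M hp2 htr) = 0 := by
  have h := congrArg (coeff 0) (map_hondaIsoInv hp2 htr)
  rw [coeff_map, PowerSeries.coeff_zero_eq_constantCoeff, PowerSeries.coeff_zero_eq_constantCoeff,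
    constantCoeff_hondaPsiInv] at h
  exact Subtype.ext h

/-- **`i ∘ j = X`** over `ℤ_p`. [cite: Kobayashi2003, Prop. 8.4] -/
theorem hondaIso_subst_hondaIsoInv : (hondaIso p M hp2 htr).subst (hondaIsoInv p M hp2 htr) = X := by
  apply map_injective
  rw [map_subst_apply (HasSubst.of_constantCoeff_zero' (constantCoeff_hondaIsoInv hp2 htr)),
    map_hondaIso, map_hondaIsoInv, PowerSeries.map_X]
  exact hondaPsi_subst_hondaPsiInv p M

end HondaFss

end Literature.NumberTheory.EllipticCurves.Sprung2012.Honda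

end Part6

/-!
## Part 7 — port of `Summits/BirchSwinnertonDyer/Rank1Residual/Additive/KobayashiLogFssValues.lean` (3 declarations kept)

# The values of Kobayashi's logarithm: `log_{F_ss}(x) = ∑ₖ (−1)ᵏ((1+x)^{p^{2k}} − 1)/pᵏ` at every
# point `‖x‖ < 1` of a complete ultrametric normed `ℚ_p`-algebra (rearrangement), the finite form
# when `(1+x)^{p^{2k}} = 1` eventually (roots of unity), and the CONGRUENCE form
# `log_{F_ss}(x) ∈ K' + 𝒪_K` when `p`-th powers of `𝒪_K` lie in `𝒪_{K'} + p𝒪_K`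
#

(Port of the declarations listed in the Part header; the source module's docstring — cell bookkeeping of the BSD
printed-inputs programme — is abridged to its title here.)
-/

section Part7

open scoped _root_.Classical _root_.Topology
open _root_.Filter _root_.PowerSeries _root_.Finset

namespace Literature.NumberTheory.EllipticCurves.Sprung2012.Honda

namespace HondaFss

open BallEval

variable (p : ℕ) [hp : Fact p.Prime] (K : Type*) [NontriviallyNormedField K] [NormedAlgebra ℚ_[p] K]
  [IsUltrametricDist K] [CompleteSpace K]

/-! ## §1 The double family -/

variable {p K}

omit [IsUltrametricDist K] [CompleteSpace K] in
/-- `‖p‖ = p⁻¹` in `K`. [cite: Kobayashi2003, §8.2] -/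
theorem norm_natCast_p : ‖(p : K)‖ = (p : ℝ)⁻¹ := by
  have h : (p : K) = algebraMap ℚ_[p] K (p : ℚ_[p]) := by rw [map_natCast]
  rw [h, norm_algebraMap_padic, Padic.norm_p]

omit [CompleteSpace K] in
/-- `p`-th powers improve congruences: `‖a − b‖ ≤ ‖p‖ʲ`, `‖b‖ ≤ 1`, `j ≥ 1` ⇒ `‖aᵖ − bᵖ‖ ≤ ‖p‖^{j+1}`.
[cite: Kobayashi2003, §8.2] -/
theorem norm_pow_p_sub_pow_p_le {a b : K} (hb : ‖b‖ ≤ 1) {j : ℕ} (hj : 1 ≤ j)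
    (hab : ‖a - b‖ ≤ ‖(p : K)‖ ^ j) : ‖a ^ p - b ^ p‖ ≤ ‖(p : K)‖ ^ (j + 1) := by
  obtain ⟨hq0, hq1⟩ : 0 < ‖(p : K)‖ ∧ ‖(p : K)‖ < 1 := by
    rw [norm_natCast_p]
    exact ⟨inv_pos.mpr (by exact_mod_cast hp.out.pos), inv_lt_one_of_one_lt₀ (by exact_mod_cast hp.out.one_lt)⟩
  set e := a - b with he
  have ha : a = b + e := by rw [he]; ring
  have he1 : ‖e‖ ≤ ‖(p : K)‖ ^ j := hab
  have he1' : ‖e‖ ≤ 1 := he1.trans (pow_le_one₀ hq0.le hq1.le)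
  rw [ha, add_pow]
  -- split off the term `m = p` (which is `b^0 ... `): write the sum over `range (p+1)` as the `m=0` term `b^p`… we use
  -- `(b+e)^p - b^p = ∑_{m=1}^{p} e^m b^{p-m} C(p,m)` after reindexing `add_pow` with `x = e`? `add_pow` expands
  -- `(b + e)^p = ∑ b^m e^{p-m} C(p,m)`; the `m = p` term is `b^p`.
  rw [Finset.sum_range_succ, Nat.choose_self, Nat.cast_one, mul_one, Nat.sub_self, pow_zero, mul_one,
    add_sub_cancel_right]
  refine IsUltrametricDist.norm_sum_le_of_forall_le_of_nonneg (by positivity) fun m hm => ?_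
  rw [mem_range] at hm
  rw [norm_mul, norm_mul, norm_pow, norm_pow]
  have hpm : 1 ≤ p - m := Nat.one_le_iff_ne_zero.mpr (by omega)
  by_cases hm1 : p - m = 1
  · -- `m = p - 1`: the term is `p · b^{p-1} e`
    have hmp : m = p - 1 := by omega
    rw [hm1, pow_one]
    have hC : ((p.choose m : ℕ) : K) = p := by
      rw [hmp, Nat.choose_symm hp.out.one_lt.le, Nat.choose_one_right]
    rw [hC]
    calc ‖b‖ ^ m * ‖e‖ * ‖(p : K)‖ ≤ 1 * ‖(p : K)‖ ^ j * ‖(p : K)‖ := by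
          refine mul_le_mul (mul_le_mul (pow_le_one₀ (norm_nonneg _) hb) he1 (norm_nonneg _) zero_le_one) le_rfl
            (norm_nonneg _) (by positivity)
      _ = ‖(p : K)‖ ^ (j + 1) := by rw [one_mul, pow_succ]
  · -- `p - m ≥ 2`: `‖e‖^{p-m} ≤ ‖p‖^{2j} ≤ ‖p‖^{j+1}`
    have h2 : 2 ≤ p - m := by omega
    have hC : ‖((p.choose m : ℕ) : K)‖ ≤ 1 := by
      have : ((p.choose m : ℕ) : K) = algebraMap ℚ_[p] K ((p.choose m : ℕ) : ℚ_[p]) := by rw [map_natCast]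
      rw [this, norm_algebraMap_padic]
      simpa using Padic.norm_int_le_one (p := p) (p.choose m : ℤ)
    calc ‖b‖ ^ m * ‖e‖ ^ (p - m) * ‖((p.choose m : ℕ) : K)‖ ≤ 1 * (‖(p : K)‖ ^ j) ^ 2 * 1 := by
          refine mul_le_mul (mul_le_mul (pow_le_one₀ (norm_nonneg _) hb) ?_ (by positivity) zero_le_one) hC
            (norm_nonneg _) (by positivity)
          calc ‖e‖ ^ (p - m) ≤ ‖e‖ ^ 2 := pow_le_pow_of_le_one (norm_nonneg _) he1' h2
            _ ≤ (‖(p : K)‖ ^ j) ^ 2 := pow_le_pow_left₀ (norm_nonneg _) he1 2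
      _ = ‖(p : K)‖ ^ (2 * j) := by rw [one_mul, mul_one, ← pow_mul, mul_comm]
      _ ≤ ‖(p : K)‖ ^ (j + 1) := pow_le_pow_of_le_one hq0.le hq1.le (by omega)

omit [CompleteSpace K] in
/-- From `yᵖ ∈ (K' ∩ 𝒪) + p𝒪` for all `y ∈ 𝒪` to **`y^{pʲ} ∈ (K' ∩ 𝒪) + pʲ𝒪`** for `j ≥ 1`.
[cite: Kobayashi2003, Prop. 8.11 (proof)] -/
theorem exists_norm_pow_sub_le (K' : Subfield K)
    (hFrob : ∀ y : K, ‖y‖ ≤ 1 → ∃ s ∈ K', ‖s‖ ≤ 1 ∧ ‖y ^ p - s‖ ≤ ‖(p : K)‖)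
    {y : K} (hy : ‖y‖ ≤ 1) {j : ℕ} (hj : 1 ≤ j) :
    ∃ s ∈ K', ‖s‖ ≤ 1 ∧ ‖y ^ p ^ j - s‖ ≤ ‖(p : K)‖ ^ j := by
  induction j, hj using Nat.le_induction with
  | base =>
    obtain ⟨s, hs, hs1, h⟩ := hFrob y hy
    exact ⟨s, hs, hs1, by simpa using h⟩
  | succ j hj ih =>
    obtain ⟨s, hs, hs1, h⟩ := ih
    refine ⟨s ^ p, K'.pow_mem hs p, by rw [norm_pow]; exact pow_le_one₀ (norm_nonneg _) hs1, ?_⟩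
    rw [pow_succ, pow_mul]
    exact norm_pow_p_sub_pow_p_le hs1 hj h

end HondaFss

end Literature.NumberTheory.EllipticCurves.Sprung2012.Honda

end Part7

/-!
## Part 8 — port of `Summits/BirchSwinnertonDyer/Rank1Residual/Additive/KobayashiHondaPoints.lean` (2 declarations kept)

# Honda points: `c(x) = P(i(x)) ∈ E₁(K)` for `x ∈ 𝔪_K` has `Λ(c(x)) = log_{F_ss}(x)`; every point of
# `E₁(K)` is a Honda point; hence `Λ(E₁(K)) ⊆ K' + 𝒪_K` whenever `p`-th powers of `𝒪_K` lie in
# `(K' ∩ 𝒪_K) + p𝒪_K`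

(Port of the declarations listed in the Part header; the source module's docstring — cell bookkeeping of the BSD
printed-inputs programme — is abridged to its title here.)
-/

section Part8

open scoped _root_.Classical _root_.Topology _root_.NNReal
open _root_.Filter _root_.PowerSeries

namespace Literature.NumberTheory.EllipticCurves.Sprung2012.Honda

namespace BallEval

open Literature.NumberTheory.GaloisRepresentations.LubinTate (unitBall mem_unitBall_iff)
open Literature.NumberTheory.EllipticCurves Literature.NumberTheory.EllipticCurves.FormalGroupChart
open _root_.WeierstrassCurve HondaFss

variable (p : ℕ) [hp : Fact p.Prime] (K : Type*) [NontriviallyNormedField K] [NormedAlgebra ℚ_[p] K]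
  [IsUltrametricDist K] [CompleteSpace K] (M : WeierstrassCurve ℤ_[p])
  [hE : (M.map PadicInt.Coe.ringHom).IsElliptic] [hEt : (M.map PadicInt.toZMod).IsElliptic]
  (hp2 : p ≠ 2) (htr : Literature.NumberTheory.EllipticCurves.HasseManin.tr (M.map PadicInt.toZMod) = 0)

/-! ## §1 Honda points and their logarithms -/

variable {p K M} in
omit [CompleteSpace K] hE hEt in
/-- `‖g(x)‖ < 1` for `g ∈ Xℤ_p⟦X⟧` and `‖x‖ < 1` (restated for convenience). [cite: Kobayashi2003, §8.4] -/
theorem norm_ev₁_lt_one_of_constantCoeff [CompleteSpace K] {g : ℤ_[p]⟦X⟧} (hg : constantCoeff g = 0)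
    {x : unitBall K} (hx : ‖(x : K)‖ < 1) :
    ‖((ev₁ p K x (hasEval_of_norm_lt_one hx) g : unitBall K) : K)‖ < 1 :=
  (norm_ev₁_le _ hx.le hg).trans_lt hx

variable {p K M hp2 htr}
variable [hint : (curveK p K M).IsIntegral (NormedField.valuation (K := K)).integer]

omit hint in
/-- `i(j(t)) = t` at points. [cite: Kobayashi2003, §8.4] -/
theorem ev₁_hondaIso_ev₁_hondaIsoInv {t : unitBall K} (ht : ‖(t : K)‖ < 1) :
    ev₁ p K (ev₁ p K t (hasEval_of_norm_lt_one ht) (hondaIsoInv p M hp2 htr))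
        (hasEval_of_norm_lt_one (norm_ev₁_lt_one_of_constantCoeff (constantCoeff_hondaIsoInv hp2 htr) ht))
        (hondaIso p M hp2 htr) = t := by
  rw [← ev₁_subst (constantCoeff_hondaIsoInv hp2 htr) (hasEval_of_norm_lt_one ht), hondaIso_subst_hondaIsoInv,
    ev₁_X]

end BallEval

end Literature.NumberTheory.EllipticCurves.Sprung2012.Honda

end Part8

/-!
## Part 9 — port of `Summits/BirchSwinnertonDyer/Rank1Residual/Additive/KobayashiTowerPoints.lean` (13 declarations kept)

# Kobayashi's points `c_m ∈ E₁(ℚ_p(ζ_{p^m}))` inside `E(ℚ̄_p)`: coordinates in the layer, the values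
# `Λ(c_m) = ℓ_m = ∑_{k<m} (−1)ᵏ(ζ_{p^{m−2k}} − 1)/pᵏ`, the TRACE IDENTITY
# `∑_{Gal(k_m/k_{m−1})} σℓ_{m+1} = −p − ℓ_{m−1}`, and the Galois behaviour of `Λ` on layer points
#

(Port of the declarations listed in the Part header; the source module's docstring — cell bookkeeping of the BSD
printed-inputs programme — is abridged to its title here.)
-/

section Part9

open scoped _root_.Classical _root_.Topology _root_.NNReal
open _root_.Filter _root_.PowerSeries _root_.Finset

namespace Literature.NumberTheory.EllipticCurves.Sprung2012.Honda

namespace BallEval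

open Literature.NumberTheory.GaloisRepresentations.LubinTate (unitBall mem_unitBall_iff)
open Literature.NumberTheory.EllipticCurves Literature.NumberTheory.EllipticCurves.FormalGroupChart
open _root_.WeierstrassCurve PadicCyclotomicTower HondaFss _root_.Field

/-- `E_Ω = (M ⊗ ℚ_p) ⊗ ℚ̄_p`, the curve over `Ω = ℚ̄_p` (reducible abbreviation). [cite: Kobayashi2003, §8.4] -/
abbrev genFibΩ (p : ℕ) [Fact p.Prime] (M : WeierstrassCurve ℤ_[p]) : WeierstrassCurve (PadicAlgCl p) :=
  (M.map (PadicInt.Coe.ringHom (p := p))).baseChange (PadicAlgCl p)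

variable (p : ℕ) [hp : Fact p.Prime] (M : WeierstrassCurve ℤ_[p])
  [hE : (M.map PadicInt.Coe.ringHom).IsElliptic] [hEt : (M.map PadicInt.toZMod).IsElliptic]
  (hp2 : p ≠ 2) (htr : Literature.NumberTheory.EllipticCurves.HasseManin.tr (M.map PadicInt.toZMod) = 0)

/-! ## §1 The points `c_m` and their logarithms -/

/-- **The parameter `ζ_m − 1 ∈ 𝒪_{K_m}`.** [cite: Kobayashi2003, §8.4] -/
def towerParam (m : ℕ) : unitBall (LayerField p m) :=
  ⟨LayerField.mk p m (zeta p m - 1) (IntermediateField.sub_mem _ (zeta_mem_layer p m) (IntermediateField.one_mem _)),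
    (mem_unitBall_iff _).mpr (by rw [← LayerField.norm_emb, LayerField.emb_mk]; exact norm_zeta_sub_one_le_one p m)⟩

variable {p} in
/-- `‖ζ_m − 1‖ < 1` (`m ≥ 1`). [cite: Kobayashi2003, §8.4] -/
theorem norm_towerParam_lt_one {m : ℕ} (hm : 1 ≤ m) : ‖((towerParam p m : unitBall (LayerField p m)) : LayerField p m)‖ < 1 := by
  change ‖LayerField.mk p m (zeta p m - 1) _‖ < 1
  rw [← LayerField.norm_emb, LayerField.emb_mk]
  exact norm_zeta_sub_one_lt_one p hm

variable {p} in
/-- `emb (ζ_m − 1) = ζ_m − 1`. [cite: Kobayashi2003, §8.4] -/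
theorem emb_towerParam (m : ℕ) :
    LayerField.emb p m ((towerParam p m : unitBall (LayerField p m)) : LayerField p m) = zeta p m - 1 := rfl

variable {p M hp2 htr}

variable [hintΩ : (genFibΩ p M).IsIntegral (Valued.v (R := PadicAlgCl p)).integer]

omit hE hEt hintΩ in
/-- `bLogΩ 0 = 0`. [cite: Kobayashi2003, §8.4] -/
theorem bLogΩ_zero : bLogΩ p M 0 = 0 := by
  rw [bLogΩ]
  refine (tsum_congr fun n => ?_).trans tsum_zero
  rcases Nat.eq_zero_or_pos n with rfl | hn
  · rw [coeff_zero_eq_zero (norm_coeff_logQ_le (p := p) (M := M)), map_zero, zero_mul]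
  · rw [zero_pow hn.ne', mul_zero]

omit hE hEt hintΩ in
/-- `Λ(O) = 0` on `Ω`-points. [cite: Kobayashi2003, §8.4] -/
theorem ptLogΩ_zero : ptLogΩ p M (0 : (genFibΩ p M).toAffine.Point) = 0 := by
  rw [ptLogΩ, Affine.Point.zCoord_zero, bLogΩ_zero]

omit hE hEt hintΩ in
/-- `z(act σ Q) = σ • z(Q)`. [cite: Kobayashi2003, §8.4] -/
theorem zCoord_act (act : Field.absoluteGaloisGroup ℚ_[p] → (genFibΩ p M).toAffine.Point → (genFibΩ p M).toAffine.Point)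
    (hact0 : ∀ σ, act σ 0 = 0)
    (hact : ∀ σ (x y : PadicAlgCl p) (h : (genFibΩ p M).toAffine.Nonsingular x y),
      ∃ h', act σ (Affine.Point.some x y h) = Affine.Point.some (σ • x) (σ • y) h')
    (σ : Field.absoluteGaloisGroup ℚ_[p]) (Q : (genFibΩ p M).toAffine.Point) : (act σ Q).zCoord = σ • Q.zCoord := by
  rcases Q with _ | ⟨x, y, h⟩
  · rw [show (Affine.Point.zero : (genFibΩ p M).toAffine.Point) = 0 from rfl, hact0, Affine.Point.zCoord_zero,
      smul_zero]
  · obtain ⟨h', e⟩ := hact σ x y h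
    rw [e, Affine.Point.zCoord_some, Affine.Point.zCoord_some, Field.absoluteGaloisGroup.smul_def σ x,
      Field.absoluteGaloisGroup.smul_def σ y, Field.absoluteGaloisGroup.smul_def σ (-x / y), map_div₀, map_neg]

omit hE hEt hintΩ in
/-- `act σ` preserves the layer points `L(m)`. [cite: Kobayashi2003, §8.4] -/
theorem act_mem_subfieldPoints (act : Field.absoluteGaloisGroup ℚ_[p] → (genFibΩ p M).toAffine.Point → (genFibΩ p M).toAffine.Point)
    (hact0 : ∀ σ, act σ 0 = 0)
    (hact : ∀ σ (x y : PadicAlgCl p) (h : (genFibΩ p M).toAffine.Nonsingular x y),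
      ∃ h', act σ (Affine.Point.some x y h) = Affine.Point.some (σ • x) (σ • y) h')
    (σ : Field.absoluteGaloisGroup ℚ_[p]) {m : ℕ} {Q : (genFibΩ p M).toAffine.Point}
    (hQ : Q ∈ subfieldPoints (genFibΩ p M) (layer p m).toSubfield coeffs_mem_layer) :
    act σ Q ∈ subfieldPoints (genFibΩ p M) (layer p m).toSubfield coeffs_mem_layer := by
  rcases Q with _ | ⟨x, y, h⟩
  · change act σ 0 ∈ _; rw [hact0]; exact (subfieldPoints _ _ _).zero_mem
  · obtain ⟨h', e⟩ := hact σ x y h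
    obtain ⟨hx, hy⟩ := (some_mem_subfieldPoints_iff _ h).mp hQ
    rw [e, some_mem_subfieldPoints_iff]
    exact ⟨smul_mem_layer σ hx, smul_mem_layer σ hy⟩

omit hE hEt in
/-- `act σ` preserves `E₁` (`σ` is an isometry). [cite: Kobayashi2003, §8.4] -/
theorem act_mem_kernel (act : Field.absoluteGaloisGroup ℚ_[p] → (genFibΩ p M).toAffine.Point → (genFibΩ p M).toAffine.Point)
    (hact0 : ∀ σ, act σ 0 = 0)
    (hact : ∀ σ (x y : PadicAlgCl p) (h : (genFibΩ p M).toAffine.Nonsingular x y),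
      ∃ h', act σ (Affine.Point.some x y h) = Affine.Point.some (σ • x) (σ • y) h')
    (σ : Field.absoluteGaloisGroup ℚ_[p]) {Q : (genFibΩ p M).toAffine.Point} (hQ : Q ∈ kernel (Valued.v (R := PadicAlgCl p)) (genFibΩ p M)) :
    act σ Q ∈ kernel (Valued.v (R := PadicAlgCl p)) (genFibΩ p M) := by
  rcases Q with _ | ⟨x, y, h⟩
  · change act σ 0 ∈ _; rw [hact0]; exact (kernel (Valued.v (R := PadicAlgCl p)) (genFibΩ p M)).zero_mem
  · obtain ⟨h', e⟩ := hact σ x y h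
    rw [e]
    refine some_mem_kernel _ ?_
    have hx := (some_mem_kernel_iff h).mp hQ
    rw [Field.absoluteGaloisGroup.smul_def σ x, PadicAlgCl.valuation_def, ← NNReal.coe_lt_coe, coe_nnnorm,
      ← PadicAlgCl.spectralNorm_eq, ← spectralNorm_eq_of_equiv (Field.absoluteGaloisGroup.toAlgEquiv ℚ_[p] σ) x,
      PadicAlgCl.spectralNorm_eq]
    rwa [PadicAlgCl.valuation_def, ← NNReal.coe_lt_coe, coe_nnnorm] at hx

omit hE hEt hintΩ in
/-- **`Λ(act σ Q) = σ • Λ(Q)`** for `‖z Q‖ < 1`. [cite: Kobayashi2003, §8.4] -/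
theorem ptLogΩ_act (act : Field.absoluteGaloisGroup ℚ_[p] → (genFibΩ p M).toAffine.Point → (genFibΩ p M).toAffine.Point)
    (hact0 : ∀ σ, act σ 0 = 0)
    (hact : ∀ σ (x y : PadicAlgCl p) (h : (genFibΩ p M).toAffine.Nonsingular x y),
      ∃ h', act σ (Affine.Point.some x y h) = Affine.Point.some (σ • x) (σ • y) h')
    (σ : Field.absoluteGaloisGroup ℚ_[p]) {Q : (genFibΩ p M).toAffine.Point} (hQ : ‖Q.zCoord‖ < 1) :
    ptLogΩ p M (act σ Q) = σ • ptLogΩ p M Q := by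
  show bLogΩ p M (act σ Q).zCoord = σ • bLogΩ p M Q.zCoord
  rw [zCoord_act act hact0 hact, Field.absoluteGaloisGroup.smul_def σ Q.zCoord,
    Field.absoluteGaloisGroup.smul_def σ (bLogΩ p M Q.zCoord), bLogΩ_algEquiv _ hQ]

omit hE hEt hintΩ in
/-- A point fixed by `stab p m'` (under `act`) has coordinates in `layer m'`. [cite: Kobayashi2003, §8.4] -/
theorem mem_subfieldPoints_of_forall_act_eq (act : Field.absoluteGaloisGroup ℚ_[p] → (genFibΩ p M).toAffine.Point → (genFibΩ p M).toAffine.Point)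
    (hact : ∀ σ (x y : PadicAlgCl p) (h : (genFibΩ p M).toAffine.Nonsingular x y),
      ∃ h', act σ (Affine.Point.some x y h) = Affine.Point.some (σ • x) (σ • y) h')
    {m' : ℕ} {Q : (genFibΩ p M).toAffine.Point}
    (h : ∀ σ ∈ stab p m', act σ Q = Q) : Q ∈ subfieldPoints (genFibΩ p M) (layer p m').toSubfield coeffs_mem_layer := by
  rcases Q with _ | ⟨x, y, hxy⟩
  · exact (subfieldPoints _ _ _).zero_mem
  · rw [some_mem_subfieldPoints_iff]
    constructor
    · refine (mem_layer_iff_forall_smul_eq x).mpr fun σ hσ => ?_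
      obtain ⟨h', e⟩ := hact σ x y hxy
      have := h σ hσ
      rw [e] at this
      exact (Affine.Point.some.inj this).1
    · refine (mem_layer_iff_forall_smul_eq y).mpr fun σ hσ => ?_
      obtain ⟨h', e⟩ := hact σ x y hxy
      have := h σ hσ
      rw [e] at this
      exact (Affine.Point.some.inj this).2

omit hEt in
/-- `ΛΩ` of a difference on `L(m) ∩ E₁`. [cite: Kobayashi2003, §8.4] -/
theorem ptLogΩ_sub {m : ℕ} {Q₁ Q₂ : (genFibΩ p M).toAffine.Point}
    (h₁ : Q₁ ∈ subfieldPoints (genFibΩ p M) (layer p m).toSubfield coeffs_mem_layer)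
    (h₂ : Q₂ ∈ subfieldPoints (genFibΩ p M) (layer p m).toSubfield coeffs_mem_layer)
    (hk₁ : Q₁ ∈ kernel (Valued.v (R := PadicAlgCl p)) (genFibΩ p M)) (hk₂ : Q₂ ∈ kernel (Valued.v (R := PadicAlgCl p)) (genFibΩ p M)) :
    ptLogΩ p M (Q₁ - Q₂) = ptLogΩ p M Q₁ - ptLogΩ p M Q₂ := by
  haveI := isIntegral_curveK p (LayerField p m) M
  have h := ptLogΩ_add (m := m) ((subfieldPoints _ _ _).sub_mem h₁ h₂) h₂
    ((kernel (Valued.v (R := PadicAlgCl p)) (genFibΩ p M)).sub_mem hk₁ hk₂) hk₂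
  rw [sub_add_cancel] at h
  linear_combination -h

omit hEt in
/-- **A point of `L(m) ∩ E₁` whose logarithm lies in `layer m'` lies in `L(m')`** (`m' ≤ m`), provided
`L(m)` has no `p`-power torsion: for `τ ∈ stab m'`, `Λ(act τ Q − Q) = τΛ(Q) − Λ(Q) = 0`, so
`act τ Q − Q` is `p`-power torsion, hence `0`. [cite: Kobayashi2003, §8.4] -/
theorem mem_subfieldPoints_of_ptLogΩ_mem (act : Field.absoluteGaloisGroup ℚ_[p] → (genFibΩ p M).toAffine.Point → (genFibΩ p M).toAffine.Point)
    (hact0 : ∀ σ, act σ 0 = 0)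
    (hact : ∀ σ (x y : PadicAlgCl p) (h : (genFibΩ p M).toAffine.Nonsingular x y),
      ∃ h', act σ (Affine.Point.some x y h) = Affine.Point.some (σ • x) (σ • y) h')
    {m m' : ℕ}
    (htors : ∀ Q ∈ subfieldPoints (genFibΩ p M) (layer p m).toSubfield coeffs_mem_layer, ∀ k : ℕ, p ^ k • Q = 0 → Q = 0)
    {Q : (genFibΩ p M).toAffine.Point} (hQ : Q ∈ subfieldPoints (genFibΩ p M) (layer p m).toSubfield coeffs_mem_layer)
    (hk : Q ∈ kernel (Valued.v (R := PadicAlgCl p)) (genFibΩ p M)) (hΛ : ptLogΩ p M Q ∈ layer p m') :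
    Q ∈ subfieldPoints (genFibΩ p M) (layer p m').toSubfield coeffs_mem_layer := by
  haveI := isIntegral_curveK p (LayerField p m) M
  refine mem_subfieldPoints_of_forall_act_eq act hact fun τ hτ => ?_
  -- `D = act τ Q − Q`
  have hDL : act τ Q - Q ∈ subfieldPoints (genFibΩ p M) (layer p m).toSubfield coeffs_mem_layer :=
    (subfieldPoints _ _ _).sub_mem (act_mem_subfieldPoints act hact0 hact τ hQ) hQ
  have hDk : act τ Q - Q ∈ kernel (Valued.v (R := PadicAlgCl p)) (genFibΩ p M) :=
    (kernel (Valued.v (R := PadicAlgCl p)) (genFibΩ p M)).sub_mem (act_mem_kernel act hact0 hact τ hk) hk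
  have hzQ : ‖Q.zCoord‖ < 1 := by
    have := val_zCoord_lt_one hk
    rwa [PadicAlgCl.valuation_def, ← NNReal.coe_lt_coe, coe_nnnorm, NNReal.coe_one] at this
  have hΛD : ptLogΩ p M (act τ Q - Q) = 0 := by
    rw [ptLogΩ_sub (m := m) (act_mem_subfieldPoints act hact0 hact τ hQ) hQ (act_mem_kernel act hact0 hact τ hk) hk,
      ptLogΩ_act act hact0 hact τ hzQ, smul_eq_self_of_mem_stab hτ hΛ, sub_self]
  obtain ⟨k, hk0⟩ := exists_pow_smul_eq_zero_of_ptLogΩ_eq_zero (m := m) hDL hDk hΛD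
  have hD0 := htors _ hDL k hk0
  exact sub_eq_zero.mp hD0

end BallEval

end Literature.NumberTheory.EllipticCurves.Sprung2012.Honda

end Part9

/-!
## Part 10 — port of `Summits/BirchSwinnertonDyer/Rank1Residual/Additive/PadicBallLogSurj.lean` (17 declarations kept)

# Local surjectivity of the logarithm of `E₁(K)`: every `y` with `‖y‖ ≤ 1/4` is `Λ(P)` for some
# `P ∈ E₁(K)` with `‖z(P)‖ ≤ ‖y‖` (successive approximation in the complete field `K ⊇ ℚ_p`)
#

(Port of the declarations listed in the Part header; the source module's docstring — cell bookkeeping of the BSD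
printed-inputs programme — is abridged to its title here.)
-/

section Part10

open scoped _root_.Classical _root_.Topology _root_.NNReal
open _root_.Filter _root_.PowerSeries

namespace Literature.NumberTheory.EllipticCurves.Sprung2012.Honda

namespace BallEval

open Literature.NumberTheory.GaloisRepresentations.LubinTate (unitBall mem_unitBall_iff)
open Literature.NumberTheory.EllipticCurves Literature.NumberTheory.EllipticCurves.FormalGroupChart
open _root_.WeierstrassCurve

variable (p : ℕ) [hp : Fact p.Prime] (K : Type*) [NontriviallyNormedField K] [NormedAlgebra ℚ_[p] K]
  [IsUltrametricDist K] [CompleteSpace K] (M : WeierstrassCurve ℤ_[p])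
  [hE : (M.map PadicInt.Coe.ringHom).IsElliptic]
  [hint : (curveK p K M).IsIntegral (NormedField.valuation (K := K)).integer]

/-! ## §1 The formal point of a parameter in `K` and the correction map -/

/-- **`pt x`**: the formal point of parameter `x` (`O` if `‖x‖ ≥ 1`). [cite: SilvermanAEC2009, IV.6.4] -/
def pt (x : K) : (curveK p K M).toAffine.Point :=
  if hx : ‖x‖ < 1 then ptOf p K M ⟨x, (mem_unitBall_iff K).mpr hx.le⟩ hx else 0

variable {p K M}

omit hint in
/-- `pt x` for `‖x‖ < 1`. [cite: SilvermanAEC2009, IV.6.4] -/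
theorem pt_of_lt {x : K} (hx : ‖x‖ < 1) : pt p K M x = ptOf p K M ⟨x, (mem_unitBall_iff K).mpr hx.le⟩ hx := by
  rw [pt, dif_pos hx]

/-- `pt x ∈ E₁(K)`. [cite: SilvermanAEC2009, IV.6.4] -/
theorem pt_mem_kernel (x : K) : pt p K M x ∈ kernel (NormedField.valuation (K := K)) (curveK p K M) := by
  by_cases hx : ‖x‖ < 1
  · rw [pt_of_lt hx]; exact ptOf_mem_kernel hx
  · rw [pt, dif_neg hx]; exact (kernel (NormedField.valuation (K := K)) (curveK p K M)).zero_mem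

omit hint in
/-- `z(pt x) = x` for `‖x‖ < 1`. [cite: SilvermanAEC2009, IV.6.4] -/
theorem zCoord_pt {x : K} (hx : ‖x‖ < 1) : (pt p K M x).zCoord = x := by
  rw [pt_of_lt hx, zCoord_ptOf]

omit hint in
/-- `Λ(pt x) = bLog x` for `‖x‖ < 1`. [cite: SilvermanAEC2009, IV.6.4] -/
theorem ptLog_pt {x : K} (hx : ‖x‖ < 1) : ptLog p K M (pt p K M x) = bLog p K M x := by
  rw [ptLog, zCoord_pt hx]

variable (p K M) in
/-- **The correction map `corr x = x − Λ(pt x)`.** [cite: SilvermanAEC2009, IV.6.4] -/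
def corr (x : K) : K := x - ptLog p K M (pt p K M x)

omit hint in
/-- `‖corr x‖ ≤ 2‖x‖²` for `‖x‖ ≤ 1/2`. [cite: SilvermanAEC2009, IV.6.4] -/
theorem norm_corr_le {x : K} (hx : ‖x‖ ≤ 1 / 2) : ‖corr p K M x‖ ≤ ‖x‖ ^ 2 * 2 := by
  have hx1 : ‖x‖ < 1 := hx.trans_lt (by norm_num)
  rw [corr, ptLog_pt hx1, ← norm_neg, neg_sub]
  exact norm_bLog_sub_le_two hx

omit hint in
/-- `‖corr x‖ ≤ ‖x‖/2` for `‖x‖ ≤ 1/4`. [cite: SilvermanAEC2009, IV.6.4] -/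
theorem norm_corr_le_half {x : K} (hx : ‖x‖ ≤ 1 / 4) : ‖corr p K M x‖ ≤ ‖x‖ / 2 := by
  refine (norm_corr_le (hx.trans (by norm_num))).trans ?_
  have h0 := norm_nonneg x
  nlinarith

omit hint in
/-- The iterates `rₙ = corrⁿ(y)` satisfy `‖rₙ‖ ≤ ‖y‖ / 2ⁿ` (for `‖y‖ ≤ 1/4`). [cite: SilvermanAEC2009, IV.6.4] -/
theorem norm_iterate_corr_le {y : K} (hy : ‖y‖ ≤ 1 / 4) (n : ℕ) : ‖(corr p K M)^[n] y‖ ≤ ‖y‖ / 2 ^ n := by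
  induction n with
  | zero => simp
  | succ n ih =>
    rw [Function.iterate_succ_apply']
    have hn : ‖(corr p K M)^[n] y‖ ≤ 1 / 4 := ih.trans ((div_le_self (norm_nonneg y) (one_le_pow₀ one_le_two)).trans hy)
    refine (norm_corr_le_half hn).trans ?_
    rw [pow_succ, ← div_div]
    exact div_le_div_of_nonneg_right ih zero_le_two

omit hint in
/-- Hence `‖rₙ‖ ≤ ‖y‖`. [cite: SilvermanAEC2009, IV.6.4] -/
theorem norm_iterate_corr_le' {y : K} (hy : ‖y‖ ≤ 1 / 4) (n : ℕ) : ‖(corr p K M)^[n] y‖ ≤ ‖y‖ :=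
  (norm_iterate_corr_le hy n).trans (div_le_self (norm_nonneg y) (one_le_pow₀ one_le_two))

/-! ## §2 The partial sums -/

/-- **`Λ(∑_{i<n} pt rᵢ) = y − rₙ`** (telescoping: `Λ(pt rᵢ) = rᵢ − r_{i+1}`). [cite: SilvermanAEC2009, IV.6.4] -/
theorem ptLog_sum_pt_iterate (y : K) (n : ℕ) :
    ptLog p K M (∑ i ∈ Finset.range n, pt p K M ((corr p K M)^[i] y)) = y - (corr p K M)^[n] y := by
  induction n with
  | zero => rw [Finset.sum_range_zero, ptLog_zero, Function.iterate_zero_apply, sub_self]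
  | succ n ih =>
    rw [Finset.sum_range_succ, ptLog_add ((kernel (NormedField.valuation (K := K)) (curveK p K M)).sum_mem fun _ _ => pt_mem_kernel _) (pt_mem_kernel _), ih,
      Function.iterate_succ_apply', corr]
    ring

/-- The sums lie in `E₁(K)`. [cite: SilvermanAEC2009, IV.6.4] -/
theorem sum_pt_mem_kernel (y : K) (n : ℕ) :
    (∑ i ∈ Finset.range n, pt p K M ((corr p K M)^[i] y)) ∈ kernel (NormedField.valuation (K := K)) (curveK p K M) :=
  (kernel (NormedField.valuation (K := K)) (curveK p K M)).sum_mem fun _ _ => pt_mem_kernel _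

omit [CompleteSpace K] hE in
/-- Norm form of the chart estimate `|z(P + Q)| ≤ max |z P| |z Q|`. [cite: SilvermanAEC2009, IV.6.4] -/
theorem norm_zCoord_add_le {P Q : (curveK p K M).toAffine.Point}
    (hP : P ∈ kernel (NormedField.valuation (K := K)) (curveK p K M))
    (hQ : Q ∈ kernel (NormedField.valuation (K := K)) (curveK p K M)) :
    ‖(P + Q).zCoord‖ ≤ max ‖P.zCoord‖ ‖Q.zCoord‖ := by
  have h := val_zCoord_add_le (w := NormedField.valuation (K := K)) hP hQ
  have h' : ((NormedField.valuation (K := K) (P + Q).zCoord : ℝ≥0) : ℝ) ≤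
      ((max (NormedField.valuation (K := K) P.zCoord) (NormedField.valuation (K := K) Q.zCoord) : ℝ≥0) : ℝ) := by
    exact_mod_cast h
  simpa [NormedField.valuation_apply, NNReal.coe_max] using h'

omit [CompleteSpace K] hE in
/-- Norm form of the isometry `|z(P − Q)| = |z P − z Q|`. [cite: SilvermanAEC2009, IV.6.4] -/
theorem norm_zCoord_sub_eq {P Q : (curveK p K M).toAffine.Point}
    (hP : P ∈ kernel (NormedField.valuation (K := K)) (curveK p K M))
    (hQ : Q ∈ kernel (NormedField.valuation (K := K)) (curveK p K M)) :
    ‖(P - Q).zCoord‖ = ‖P.zCoord - Q.zCoord‖ := by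
  have h := val_zCoord_sub (w := NormedField.valuation (K := K)) hP hQ
  have h' := congrArg (fun x : ℝ≥0 => (x : ℝ)) h
  simp only [NormedField.valuation_apply, coe_nnnorm] at h'
  linarith [h', h'.symm]

/-- `‖z(Sₙ)‖ ≤ ‖y‖`. [cite: SilvermanAEC2009, IV.6.4] -/
theorem norm_zCoord_sum_le {y : K} (hy : ‖y‖ ≤ 1 / 4) (n : ℕ) :
    ‖(∑ i ∈ Finset.range n, pt p K M ((corr p K M)^[i] y)).zCoord‖ ≤ ‖y‖ := by
  induction n with
  | zero => rw [Finset.sum_range_zero, Affine.Point.zCoord_zero, norm_zero]; exact norm_nonneg y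
  | succ n ih =>
    rw [Finset.sum_range_succ]
    refine (norm_zCoord_add_le (sum_pt_mem_kernel y n) (pt_mem_kernel _)).trans (max_le ih ?_)
    have h1 : ‖(corr p K M)^[n] y‖ < 1 := (norm_iterate_corr_le' hy n).trans_lt (hy.trans_lt (by norm_num))
    rw [zCoord_pt h1]
    exact norm_iterate_corr_le' hy n

/-- Consecutive differences: `‖z(S_{n+1}) − z(Sₙ)‖ ≤ ‖y‖/2ⁿ`. [cite: SilvermanAEC2009, IV.6.4] -/
theorem norm_zCoord_sum_succ_sub_le {y : K} (hy : ‖y‖ ≤ 1 / 4) (n : ℕ) :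
    ‖(∑ i ∈ Finset.range (n + 1), pt p K M ((corr p K M)^[i] y)).zCoord -
      (∑ i ∈ Finset.range n, pt p K M ((corr p K M)^[i] y)).zCoord‖ ≤ ‖y‖ / 2 ^ n := by
  have h1 : ‖(corr p K M)^[n] y‖ < 1 := (norm_iterate_corr_le' hy n).trans_lt (hy.trans_lt (by norm_num))
  rw [← norm_zCoord_sub_eq (sum_pt_mem_kernel y (n + 1)) (sum_pt_mem_kernel y n), Finset.sum_range_succ,
    add_sub_cancel_left, zCoord_pt h1]
  exact norm_iterate_corr_le hy n

/-! ## §3 Local surjectivity -/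

/-- **Local surjectivity of `Λ`**: for `‖y‖ ≤ 1/4` there is `P ∈ E₁(K)` with `Λ(P) = y` and
`‖z(P)‖ ≤ ‖y‖`. [cite: SilvermanAEC2009, IV.6.4] -/
theorem exists_ptLog_eq {y : K} (hy : ‖y‖ ≤ 1 / 4) :
    ∃ P ∈ kernel (NormedField.valuation (K := K)) (curveK p K M), ptLog p K M P = y ∧ ‖P.zCoord‖ ≤ ‖y‖ := by
  set S : ℕ → (curveK p K M).toAffine.Point := fun n => ∑ i ∈ Finset.range n, pt p K M ((corr p K M)^[i] y) with hS
  set s : ℕ → K := fun n => (S n).zCoord with hs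
  -- `s` is Cauchy, hence converges
  have hcau : CauchySeq s := by
    refine cauchySeq_of_le_geometric_two (C := 2 * ‖y‖) fun n => ?_
    rw [mul_div_cancel_left₀ _ (two_ne_zero : (2 : ℝ) ≠ 0), dist_eq_norm, ← norm_neg, neg_sub]
    exact norm_zCoord_sum_succ_sub_le (p := p) (M := M) hy n
  obtain ⟨ℓ, hℓ⟩ := cauchySeq_tendsto_of_complete hcau
  have hℓy : ‖ℓ‖ ≤ ‖y‖ :=
    le_of_tendsto (continuous_norm.continuousAt.tendsto.comp hℓ) (Filter.Eventually.of_forall fun n =>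
      norm_zCoord_sum_le (p := p) (M := M) hy n)
  have hℓ1 : ‖ℓ‖ < 1 := hℓy.trans_lt (hy.trans_lt (by norm_num))
  refine ⟨pt p K M ℓ, pt_mem_kernel (p := p) (M := M) ℓ, ?_, by rw [zCoord_pt hℓ1]; exact hℓy⟩
  -- `Λ(pt ℓ) = Λ(pt ℓ − Sₙ) + Λ(Sₙ)`, `Λ(Sₙ) = y − rₙ → y`, `‖Λ(pt ℓ − Sₙ)‖ = ‖ℓ − sₙ‖ → 0`
  have hPm : pt p K M ℓ ∈ kernel (NormedField.valuation (K := K)) (curveK p K M) := pt_mem_kernel ℓ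
  have key : ∀ n, ptLog p K M (pt p K M ℓ) - y =
      ptLog p K M (pt p K M ℓ - S n) - (corr p K M)^[n] y := by
    intro n
    have hadd := ptLog_add ((kernel (NormedField.valuation (K := K)) (curveK p K M)).sub_mem hPm (sum_pt_mem_kernel y n)) (sum_pt_mem_kernel (p := p) (K := K) (M := M) y n)
    rw [sub_add_cancel] at hadd
    rw [hadd, ptLog_sum_pt_iterate y n]
    simp only [hS]
    ring
  -- estimate both terms
  rw [← sub_eq_zero, ← norm_le_zero_iff]
  refine le_of_forall_pos_le_add fun ε hε => ?_
  rw [zero_add]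
  -- choose `n` with `‖ℓ − sₙ‖ < ε` (and small enough for the isometry) and `‖y‖/2ⁿ < ε`
  have h1 : ∀ᶠ n in atTop, ‖s n - ℓ‖ < min ε (1 / 4) := by
    have := (tendsto_iff_norm_sub_tendsto_zero.mp hℓ)
    exact this.eventually (gt_mem_nhds (lt_min hε (by norm_num)))
  have h2 : ∀ᶠ n : ℕ in atTop, ‖y‖ / 2 ^ n < ε := by
    have ht : Tendsto (fun n : ℕ => ‖y‖ / 2 ^ n) atTop (𝓝 0) := by
      have h := (tendsto_pow_atTop_nhds_zero_of_lt_one (by norm_num : (0:ℝ) ≤ 1 / 2)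
        (by norm_num : (1 / 2 : ℝ) < 1)).const_mul ‖y‖
      rw [mul_zero] at h
      refine h.congr fun n => ?_
      rw [one_div, inv_pow, div_eq_mul_inv]
    exact ht.eventually (gt_mem_nhds hε)
  obtain ⟨n, hn1, hn2⟩ := (h1.and h2).exists
  rw [key n]
  have hdiff : ‖(pt p K M ℓ - S n).zCoord‖ < min ε (1 / 4) := by
    rw [norm_zCoord_sub_eq hPm (sum_pt_mem_kernel y n), zCoord_pt hℓ1, ← norm_neg, neg_sub]
    exact hn1
  have hL : ‖ptLog p K M (pt p K M ℓ - S n)‖ < ε := by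
    rw [norm_ptLog_eq (hdiff.trans_le ((min_le_right _ _).trans (by norm_num)))]
    exact hdiff.trans_le (min_le_left _ _)
  calc ‖ptLog p K M (pt p K M ℓ - S n) - (corr p K M)^[n] y‖
      ≤ max ‖ptLog p K M (pt p K M ℓ - S n)‖ ‖(corr p K M)^[n] y‖ := by
        rw [sub_eq_add_neg]
        refine (IsUltrametricDist.norm_add_le_max _ _).trans (by rw [norm_neg])
    _ ≤ ε := max_le hL.le ((norm_iterate_corr_le hy n).trans hn2.le)

end BallEval

end Literature.NumberTheory.EllipticCurves.Sprung2012.Honda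

end Part10

/-!
## Part 11 — port of `Summits/BirchSwinnertonDyer/Rank1Residual/Additive/PadicCyclotomicIntegers.lean` (9 declarations kept)

# Integers of the layers `ℚ_p(ζ_{p^m}) ⊂ ℚ̄_p`: `𝒪 = ℤ_p[ζ − 1]` with coefficients read off by
# orthogonality, the Frobenius congruence `yᵖ ∈ 𝒪_{m−1} + p𝒪_m`, and the decomposition
# `𝒪_m ⊆ ∑_{p ∤ i} ℤ·ζⁱ + 𝒪_{m−1} + pᵃ𝒪_m`

(Port of the declarations listed in the Part header; the source module's docstring — cell bookkeeping of the BSD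
printed-inputs programme — is abridged to its title here.)
-/

section Part11

open scoped _root_.Classical
open _root_.Polynomial _root_.Finset

namespace Literature.NumberTheory.EllipticCurves.Sprung2012.Honda

namespace PadicCyclotomicTower

variable (p : ℕ) [hp : Fact p.Prime]

/-! ## §1 Norm arithmetic -/

/-- The values of `ℚ_p` are integral powers of `p`: `‖c‖ < p ⇒ ‖c‖ ≤ 1`. [cite: Kobayashi2003, Prop. 8.11] -/
theorem norm_le_one_of_norm_lt_p {c : ℚ_[p]} (hc : ‖c‖ < p) : ‖c‖ ≤ 1 := by
  by_cases h0 : c = 0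
  · rw [h0, norm_zero]; exact zero_le_one
  rw [Padic.norm_eq_zpow_neg_valuation h0] at hc ⊢
  have hp1 : (1 : ℝ) < p := by exact_mod_cast hp.out.one_lt
  have h : -c.valuation < 1 := by
    by_contra hcon
    push Not at hcon
    have := zpow_le_zpow_right₀ hp1.le hcon
    rw [zpow_one] at this
    exact absurd (lt_of_le_of_lt this hc) (lt_irrefl _)
  calc (p : ℝ) ^ (-c.valuation) ≤ (p : ℝ) ^ (0 : ℤ) := zpow_le_zpow_right₀ hp1.le (by omega)
    _ = 1 := zpow_zero _

/-- **Freshman's dream modulo `p`, two terms**: `‖(a+b)ᵖ − aᵖ − bᵖ‖ ≤ ‖p‖` for `‖a‖, ‖b‖ ≤ 1`.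
[cite: Kobayashi2003, Prop. 8.11] -/
theorem norm_add_pow_sub_le {a b : PadicAlgCl p} (ha : ‖a‖ ≤ 1) (hb : ‖b‖ ≤ 1) :
    ‖(a + b) ^ p - a ^ p - b ^ p‖ ≤ ‖(p : PadicAlgCl p)‖ := by
  have h := add_pow a b p
  -- split off `m = p` (`a^p`) and `m = 0` (`b^p`)
  rw [Finset.sum_range_succ, Nat.choose_self, Nat.cast_one, mul_one, Nat.sub_self, pow_zero, mul_one] at h
  have hsplit := Finset.sum_erase_add (range p) (fun x => a ^ x * b ^ (p - x) * (p.choose x : PadicAlgCl p))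
    (mem_range.mpr hp.out.pos)
  simp only [pow_zero, one_mul, Nat.sub_zero, Nat.choose_zero_right, Nat.cast_one, mul_one] at hsplit
  have e : (a + b) ^ p - a ^ p - b ^ p =
      ∑ m ∈ (range p).erase 0, a ^ m * b ^ (p - m) * (p.choose m : PadicAlgCl p) := by
    rw [h, ← hsplit]; ring
  rw [e]
  refine IsUltrametricDist.norm_sum_le_of_forall_le_of_nonneg (norm_nonneg _) fun m hm => ?_
  rw [Finset.mem_erase, Finset.mem_range] at hm
  obtain ⟨k, hk⟩ := hp.out.dvd_choose_self hm.1 hm.2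
  rw [hk, Nat.cast_mul, norm_mul, norm_mul, norm_mul, norm_pow, norm_pow]
  have hk1 : ‖(k : PadicAlgCl p)‖ ≤ 1 := by
    rw [← map_natCast (algebraMap ℚ_[p] (PadicAlgCl p)) k, PadicAlgCl.norm_extends]
    simpa using Padic.norm_int_le_one (p := p) (k : ℤ)
  calc ‖a‖ ^ m * ‖b‖ ^ (p - m) * (‖(p : PadicAlgCl p)‖ * ‖(k : PadicAlgCl p)‖)
      ≤ 1 * 1 * (‖(p : PadicAlgCl p)‖ * 1) := by
        gcongr
        · exact pow_le_one₀ (norm_nonneg _) ha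
        · exact pow_le_one₀ (norm_nonneg _) hb
    _ = ‖(p : PadicAlgCl p)‖ := by ring

/-- **Freshman's dream for finite sums**: `‖(∑ᵢuᵢ)ᵖ − ∑ᵢuᵢᵖ‖ ≤ ‖p‖` when all `‖uᵢ‖ ≤ 1`. [cite: Kobayashi2003, Prop. 8.11] -/
theorem norm_sum_pow_sub_sum_pow_le {ι : Type*} (s : Finset ι) (u : ι → PadicAlgCl p) (hu : ∀ i ∈ s, ‖u i‖ ≤ 1) :
    ‖(∑ i ∈ s, u i) ^ p - ∑ i ∈ s, u i ^ p‖ ≤ ‖(p : PadicAlgCl p)‖ := by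
  induction s using Finset.induction_on with
  | empty => simp [zero_pow hp.out.ne_zero]
  | @insert i s hi ih =>
    have hui : ‖u i‖ ≤ 1 := hu i (Finset.mem_insert_self i s)
    have hus : ∀ j ∈ s, ‖u j‖ ≤ 1 := fun j hj => hu j (Finset.mem_insert_of_mem hj)
    have hS : ‖∑ j ∈ s, u j‖ ≤ 1 := IsUltrametricDist.norm_sum_le_of_forall_le_of_nonneg zero_le_one hus
    rw [Finset.sum_insert hi, Finset.sum_insert hi]
    have e : (u i + ∑ j ∈ s, u j) ^ p - (u i ^ p + ∑ j ∈ s, u j ^ p) =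
        ((u i + ∑ j ∈ s, u j) ^ p - u i ^ p - (∑ j ∈ s, u j) ^ p) + ((∑ j ∈ s, u j) ^ p - ∑ j ∈ s, u j ^ p) := by
      ring
    rw [e]
    exact (IsUltrametricDist.norm_add_le_max _ _).trans (max_le (norm_add_pow_sub_le p hui hS) (ih hus))

/-- `‖aʲ − bʲ‖ ≤ ‖a − b‖` for `‖a‖, ‖b‖ ≤ 1`. [cite: Kobayashi2003, Prop. 8.11] -/
theorem norm_pow_sub_pow_le {a b : PadicAlgCl p} (ha : ‖a‖ ≤ 1) (hb : ‖b‖ ≤ 1) (j : ℕ) :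
    ‖a ^ j - b ^ j‖ ≤ ‖a - b‖ := by
  rw [← (Commute.all a b).geom_sum₂_mul j, norm_mul]
  refine mul_le_of_le_one_left (norm_nonneg _) ?_
  refine IsUltrametricDist.norm_sum_le_of_forall_le_of_nonneg zero_le_one fun i _ => ?_
  rw [norm_mul, norm_pow, norm_pow]
  calc ‖a‖ ^ i * ‖b‖ ^ (j - 1 - i) ≤ 1 * 1 :=
        mul_le_mul (pow_le_one₀ (norm_nonneg _) ha) (pow_le_one₀ (norm_nonneg _) hb) (by positivity) zero_le_one
    _ = 1 := one_mul 1

/-! ## §2 `𝒪_m = ℤ_p[ζ − 1]` -/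

/-- **Integral elements of the layer are integral polynomials in `π = ζ m − 1`**: for `x ∈ layer m`
with `‖x‖ ≤ 1` (`m ≥ 1`) there is `r ∈ ℚ_p[X]` of degree `< φ(p^m)` with all coefficients of norm
`≤ 1` and `r(ζ m − 1) = x`. [cite: SerreLocalFields1979, Ch. IV §4] -/
theorem exists_intPoly_aeval_eq {m : ℕ} (hm : 1 ≤ m) {x : PadicAlgCl p} (hx : x ∈ layer p m) (hx1 : ‖x‖ ≤ 1) :
    ∃ r : ℚ_[p][X], r.natDegree < (p ^ m).totient ∧ (∀ j, ‖r.coeff j‖ ≤ 1) ∧ aeval (zeta p m - 1) r = x := by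
  obtain ⟨r₀, hr₀, hx₀⟩ := exists_aeval_zeta_eq p hx
  set r : ℚ_[p][X] := r₀.comp (X + C 1) with hrdef
  have hdeg : r.natDegree = r₀.natDegree := by
    rw [hrdef, natDegree_comp, natDegree_X_add_C, mul_one]
  have haev : aeval (zeta p m - 1) r = x := by
    rw [hrdef, aeval_comp, map_add, aeval_X, aeval_C, map_one, sub_add_cancel, hx₀]
  refine ⟨r, by rw [hdeg]; exact hr₀, fun j => ?_, haev⟩
  -- orthogonality: `‖r_j‖ ‖π‖^j ≤ ‖x‖ ≤ 1`, and `‖π‖^j ≥ ‖π‖^{φ-1} > ‖π‖^φ = ‖p‖`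
  by_cases hj : r.natDegree < j
  · rw [coeff_eq_zero_of_natDegree_lt hj, norm_zero]; exact zero_le_one
  push Not at hj
  have hje : j < (p ^ m).totient := lt_of_le_of_lt hj (by rw [hdeg]; exact hr₀)
  have horth := norm_coeff_mul_le_norm_aeval p hm r (by rw [hdeg]; exact hr₀) j
  rw [haev] at horth
  have hπ0 := norm_zeta_sub_one_pos p hm
  have hπ1 := norm_zeta_sub_one_lt_one p hm
  have hπj : 0 < ‖zeta p m - 1‖ ^ j := pow_pos hπ0 j
  have h1 : ‖r.coeff j‖ ≤ (‖zeta p m - 1‖ ^ j)⁻¹ := by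
    rw [inv_eq_one_div, le_div_iff₀ hπj]
    exact horth.trans hx1
  -- `‖π‖^j > ‖π‖^φ = ‖p‖ = p⁻¹`
  have hnp : ‖(p : PadicAlgCl p)‖ = (p : ℝ)⁻¹ := by
    rw [← map_natCast (algebraMap ℚ_[p] (PadicAlgCl p)) p]
    exact (PadicAlgCl.norm_extends (p := p) (p : ℚ_[p])).trans Padic.norm_p
  have h2 : (p : ℝ)⁻¹ < ‖zeta p m - 1‖ ^ j := by
    rw [← hnp, ← norm_zeta_sub_one_pow p hm]
    exact pow_lt_pow_right_of_lt_one₀ hπ0 hπ1 hje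
  refine norm_le_one_of_norm_lt_p p (h1.trans_lt ?_)
  have hp0 : (0 : ℝ) < p := by exact_mod_cast hp.out.pos
  calc (‖zeta p m - 1‖ ^ j)⁻¹ < ((p : ℝ)⁻¹)⁻¹ := inv_strictAnti₀ (inv_pos.mpr hp0) h2
    _ = p := inv_inv _

/-! ## §3 The Frobenius congruence `yᵖ ∈ 𝒪_{m−1} + p𝒪_m` -/

/-- **Frobenius congruence in the cyclotomic tower**: for `y ∈ layer m`, `‖y‖ ≤ 1`, `m ≥ 1`, there is
`s ∈ layer (m − 1)` with `‖s‖ ≤ 1` and `‖yᵖ − s‖ ≤ ‖p‖` (`y = ∑cⱼπʲ`, `yᵖ ≡ ∑cⱼᵖ(ζᵖ − 1)ʲ`,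
`ζᵖ = ζ_{m−1}`). [cite: Kobayashi2003, Prop. 8.11] -/
theorem exists_frob_mem_layer_pred (hp2 : p ≠ 2) {m : ℕ} (hm : 1 ≤ m) {y : PadicAlgCl p} (hy : y ∈ layer p m)
    (hy1 : ‖y‖ ≤ 1) : ∃ s ∈ layer p (m - 1), ‖s‖ ≤ 1 ∧ ‖y ^ p - s‖ ≤ ‖(p : PadicAlgCl p)‖ := by
  obtain ⟨r, hr, hrc, hry⟩ := exists_intPoly_aeval_eq p hm hy hy1
  obtain ⟨m', rfl⟩ := Nat.exists_eq_add_of_le' hm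
  rw [Nat.add_sub_cancel]
  set π : PadicAlgCl p := zeta p (m' + 1) - 1 with hπ
  set π' : PadicAlgCl p := zeta p m' - 1 with hπ'
  set e := (p ^ (m' + 1)).totient with he
  -- `y = ∑_{j<e} c_j π^j`
  have hysum : y = ∑ j ∈ range e, algebraMap ℚ_[p] (PadicAlgCl p) (r.coeff j) * π ^ j := by
    rw [← hry, aeval_eq_sum_range' hr]
    simp only [Algebra.smul_def]
  set s : PadicAlgCl p := ∑ j ∈ range e, algebraMap ℚ_[p] (PadicAlgCl p) (r.coeff j) ^ p * π' ^ j with hs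
  have hc1 : ∀ j, ‖algebraMap ℚ_[p] (PadicAlgCl p) (r.coeff j)‖ ≤ 1 := fun j => by
    rw [PadicAlgCl.norm_extends]; exact hrc j
  have hπ1 : ‖π‖ ≤ 1 := (norm_zeta_sub_one_lt_one p hm).le
  have hπ'1 : ‖π'‖ ≤ 1 := norm_zeta_sub_one_le_one p m'
  refine ⟨s, ?_, ?_, ?_⟩
  · -- `s ∈ layer m'`
    refine Subalgebra.sum_mem _ fun j _ => ?_
    refine Subalgebra.mul_mem _ (Subalgebra.pow_mem _ (IntermediateField.algebraMap_mem _ _) _)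
      (Subalgebra.pow_mem _ ?_ _)
    exact IntermediateField.sub_mem _ (zeta_mem_layer p m') (IntermediateField.one_mem _)
  · refine IsUltrametricDist.norm_sum_le_of_forall_le_of_nonneg zero_le_one fun j _ => ?_
    rw [norm_mul, norm_pow, norm_pow]
    calc ‖algebraMap ℚ_[p] (PadicAlgCl p) (r.coeff j)‖ ^ p * ‖π'‖ ^ j ≤ 1 * 1 :=
          mul_le_mul (pow_le_one₀ (norm_nonneg _) (hc1 j)) (pow_le_one₀ (norm_nonneg _) hπ'1) (by positivity)
            zero_le_one
      _ = 1 := one_mul 1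
  · -- `‖y^p − s‖ ≤ ‖p‖`: freshman's dream, then `π^{pj} ≡ π'^j`
    have hu : ∀ j ∈ range e, ‖algebraMap ℚ_[p] (PadicAlgCl p) (r.coeff j) * π ^ j‖ ≤ 1 := fun j _ => by
      rw [norm_mul, norm_pow]
      calc _ ≤ 1 * (1 : ℝ) := mul_le_mul (hc1 j) (pow_le_one₀ (norm_nonneg _) hπ1) (by positivity) zero_le_one
        _ = 1 := one_mul 1
    have h1 := norm_sum_pow_sub_sum_pow_le p (range e) _ hu
    rw [← hysum] at h1
    -- termwise: `(c π^j)^p = c^p (π^p)^j` and `‖(π^p)^j − π'^j‖ ≤ ‖π^p − π'‖ ≤ ‖p‖`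
    have hππ' : ‖π ^ p - π'‖ ≤ ‖(p : PadicAlgCl p)‖ := by
      -- `(ζ − 1)^p ≡ ζ^p + (−1)^p = ζ' − 1`
      have h := norm_add_pow_sub_le p (a := zeta p (m' + 1)) (b := -1) (by rw [norm_zeta]) (by rw [norm_neg, norm_one])
      have hodd : ((-1 : PadicAlgCl p)) ^ p = -1 := (hp.out.odd_of_ne_two hp2).neg_one_pow
      have e : π ^ p - π' = (zeta p (m' + 1) + -1) ^ p - zeta p (m' + 1) ^ p - (-1) ^ p := by
        rw [hπ, hπ', hodd, zeta_succ_pow, sub_eq_add_neg (zeta p (m' + 1)) 1]; ring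
      rw [e]; exact h
    have h2 : ‖∑ j ∈ range e, (algebraMap ℚ_[p] (PadicAlgCl p) (r.coeff j) * π ^ j) ^ p - s‖ ≤ ‖(p : PadicAlgCl p)‖ := by
      rw [hs, ← Finset.sum_sub_distrib]
      refine IsUltrametricDist.norm_sum_le_of_forall_le_of_nonneg (norm_nonneg _) fun j _ => ?_
      rw [mul_pow, ← pow_mul, mul_comm j p, pow_mul, ← mul_sub, norm_mul, norm_pow]
      calc ‖algebraMap ℚ_[p] (PadicAlgCl p) (r.coeff j)‖ ^ p * ‖(π ^ p) ^ j - π' ^ j‖ ≤ 1 * ‖(p : PadicAlgCl p)‖ := by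
            refine mul_le_mul (pow_le_one₀ (norm_nonneg _) (hc1 j)) ?_ (norm_nonneg _) zero_le_one
            exact (norm_pow_sub_pow_le p (by rw [norm_pow]; exact pow_le_one₀ (norm_nonneg _) hπ1) hπ'1 j).trans hππ'
        _ = ‖(p : PadicAlgCl p)‖ := one_mul _
    have e : y ^ p - s = (y ^ p - ∑ j ∈ range e, (algebraMap ℚ_[p] (PadicAlgCl p) (r.coeff j) * π ^ j) ^ p) +
        (∑ j ∈ range e, (algebraMap ℚ_[p] (PadicAlgCl p) (r.coeff j) * π ^ j) ^ p - s) := by ring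
    rw [e]
    exact (IsUltrametricDist.norm_add_le_max _ _).trans (max_le h1 h2)

/-! ## §4 `𝒪_m ⊆ ℤ[Γ·ζ] + layer (m−1) + pᵃ𝒪_m` -/

/-- Powers of `ζ m` lie in the additive subgroup generated by the `Γ`-conjugates of `ζ m` together with
`layer (m−1)`: `ζⁱ = σᵢ(ζ)` for `p ∤ i`, and `ζⁱ = ζ_{m−1}^{i/p} ∈ layer (m−1)` for `p ∣ i`.
[cite: Kobayashi2003, Prop. 8.11] -/
theorem zeta_pow_mem_closure_sup {m : ℕ} (hm : 1 ≤ m) (i : ℕ) :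
    zeta p m ^ i ∈ AddSubgroup.closure (Set.range fun g : Field.absoluteGaloisGroup ℚ_[p] => g • zeta p m) ⊔
      (layer p (m - 1)).toSubalgebra.toSubring.toAddSubgroup := by
  by_cases hi : p ∣ i
  · obtain ⟨j, rfl⟩ := hi
    refine AddSubgroup.mem_sup_right ?_
    obtain ⟨m', rfl⟩ := Nat.exists_eq_add_of_le' hm
    rw [Nat.add_sub_cancel, pow_mul, zeta_succ_pow]
    exact Subalgebra.pow_mem _ (zeta_mem_layer p m') j
  · refine AddSubgroup.mem_sup_left (AddSubgroup.subset_closure ?_)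
    have hcop : i.Coprime p := (Nat.coprime_comm.mp ((Nat.Prime.coprime_iff_not_dvd hp.out).mpr hi))
    obtain ⟨σ, hσ⟩ := exists_algEquiv_apply_zeta_eq_pow p hm hcop
    refine ⟨(Field.absoluteGaloisGroup.toAlgEquiv ℚ_[p]).symm σ, ?_⟩
    change ((Field.absoluteGaloisGroup.toAlgEquiv ℚ_[p]).symm σ) • zeta p m = zeta p m ^ i
    rw [Field.absoluteGaloisGroup.smul_def, MulEquiv.apply_symm_apply, hσ]

/-- Integral polynomial values `r(ζ − 1)` with INTEGER coefficients lie in `ℤ[Γ·ζ] + layer (m−1)`. [cite: Kobayashi2003, Prop. 8.11] -/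
theorem aeval_intCast_mem_closure_sup {m : ℕ} (hm : 1 ≤ m) (N : ℕ → ℤ) (e : ℕ) :
    (∑ j ∈ range e, (N j : PadicAlgCl p) * (zeta p m - 1) ^ j) ∈
      AddSubgroup.closure (Set.range fun g : Field.absoluteGaloisGroup ℚ_[p] => g • zeta p m) ⊔
        (layer p (m - 1)).toSubalgebra.toSubring.toAddSubgroup := by
  set T := AddSubgroup.closure (Set.range fun g : Field.absoluteGaloisGroup ℚ_[p] => g • zeta p m) ⊔
    (layer p (m - 1)).toSubalgebra.toSubring.toAddSubgroup with hT
  refine AddSubgroup.sum_mem _ fun j _ => ?_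
  -- `(ζ − 1)^j = ∑ᵢ C(j,i) ζⁱ (−1)^{j−i}` is a `ℤ`-combination of powers of `ζ`
  rw [sub_eq_add_neg, add_pow]
  rw [Finset.mul_sum]
  refine AddSubgroup.sum_mem _ fun i _ => ?_
  have hz : zeta p m ^ i ∈ T := zeta_pow_mem_closure_sup p hm i
  have e1 : (N j : PadicAlgCl p) * (zeta p m ^ i * (-1) ^ (j - i) * (j.choose i : PadicAlgCl p)) =
      ((N j * (-1) ^ (j - i) * (j.choose i : ℤ) : ℤ) : PadicAlgCl p) * zeta p m ^ i := by
    push_cast; ring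
  rw [e1, ← zsmul_eq_mul]
  exact AddSubgroup.zsmul_mem _ hz _

/-- **`𝒪_m ⊆ ℤ[Γ·ζ_m] + layer (m−1) + pᵃ𝒪_m`**: for `y ∈ layer m` with `‖y‖ ≤ 1` (`m ≥ 1`) and any
`a`, there is `y' ∈ layer m`, `‖y'‖ ≤ 1`, with `y − pᵃ y'` in the additive subgroup generated by the
`Γ`-conjugates of `ζ m` and `layer (m−1)` (`y = ∑ cⱼ πʲ`, `cⱼ = Nⱼ + pᵃcⱼ'` by `PadicInt.appr`).
[cite: Kobayashi2003, Prop. 8.11] -/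
theorem exists_sub_pow_mul_mem_closure_sup {m : ℕ} (hm : 1 ≤ m) {y : PadicAlgCl p} (hy : y ∈ layer p m)
    (hy1 : ‖y‖ ≤ 1) (a : ℕ) :
    ∃ y' ∈ layer p m, ‖y'‖ ≤ 1 ∧
      y - (p : PadicAlgCl p) ^ a * y' ∈
        AddSubgroup.closure (Set.range fun g : Field.absoluteGaloisGroup ℚ_[p] => g • zeta p m) ⊔
          (layer p (m - 1)).toSubalgebra.toSubring.toAddSubgroup := by
  obtain ⟨r, hr, hrc, hry⟩ := exists_intPoly_aeval_eq p hm hy hy1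
  set e := (p ^ m).totient with he
  set π : PadicAlgCl p := zeta p m - 1 with hπ
  -- integral coefficients as elements of `ℤ_p`, approximated by naturals mod `p^a`
  set c : ℕ → ℤ_[p] := fun j => ⟨r.coeff j, hrc j⟩ with hc
  set N : ℕ → ℕ := fun j => (c j).appr a with hN
  have happr : ∀ j, ∃ d : ℤ_[p], c j - (N j : ℤ_[p]) = (p : ℤ_[p]) ^ a * d := fun j => by
    have h := PadicInt.appr_spec a (c j)
    rw [Ideal.mem_span_singleton] at h
    exact h
  choose d hd using happr
  set y' : PadicAlgCl p := ∑ j ∈ range e, algebraMap ℚ_[p] (PadicAlgCl p) ((d j : ℤ_[p]) : ℚ_[p]) * π ^ j with hy'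
  have hπ1 : ‖π‖ ≤ 1 := norm_zeta_sub_one_le_one p m
  refine ⟨y', ?_, ?_, ?_⟩
  · refine Subalgebra.sum_mem _ fun j _ => Subalgebra.mul_mem _ (IntermediateField.algebraMap_mem _ _)
      (Subalgebra.pow_mem _ (IntermediateField.sub_mem _ (zeta_mem_layer p m) (IntermediateField.one_mem _)) _)
  · refine IsUltrametricDist.norm_sum_le_of_forall_le_of_nonneg zero_le_one fun j _ => ?_
    rw [norm_mul, norm_pow, PadicAlgCl.norm_extends]
    calc ‖((d j : ℤ_[p]) : ℚ_[p])‖ * ‖π‖ ^ j ≤ 1 * 1 :=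
          mul_le_mul (PadicInt.norm_le_one _) (pow_le_one₀ (norm_nonneg _) hπ1) (by positivity) zero_le_one
      _ = 1 := one_mul 1
  · -- `y − p^a y' = ∑ N_j π^j`
    have hysum : y = ∑ j ∈ range e, algebraMap ℚ_[p] (PadicAlgCl p) (r.coeff j) * π ^ j := by
      rw [← hry, aeval_eq_sum_range' hr]
      simp only [Algebra.smul_def]
    have hdiff : y - (p : PadicAlgCl p) ^ a * y' = ∑ j ∈ range e, ((N j : ℤ) : PadicAlgCl p) * π ^ j := by
      rw [hysum, hy', Finset.mul_sum, ← Finset.sum_sub_distrib]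
      refine Finset.sum_congr rfl fun j _ => ?_
      have hcj : r.coeff j = ((c j : ℤ_[p]) : ℚ_[p]) := rfl
      have hdj : ((c j : ℤ_[p]) : ℚ_[p]) = (N j : ℚ_[p]) + (p : ℚ_[p]) ^ a * ((d j : ℤ_[p]) : ℚ_[p]) := by
        have := congrArg (fun z : ℤ_[p] => (z : ℚ_[p])) (hd j)
        push_cast at this
        linear_combination this
      rw [hcj, hdj, map_add, map_mul, map_pow, map_natCast, map_natCast]
      push_cast
      ring
    rw [hdiff]
    exact aeval_intCast_mem_closure_sup p hm (fun j => (N j : ℤ)) e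

end PadicCyclotomicTower

end Literature.NumberTheory.EllipticCurves.Sprung2012.Honda

end Part11

/-!
## Part 12 — port of `Summits/BirchSwinnertonDyer/Rank1Residual/Additive/KobayashiTowerGeneration.lean` (3 declarations kept)

# Kobayashi's generation step (Prop. 8.11/8.12 ii)): every `P ∈ E₁(ℚ_p(ζ_{p^m}))` is, modulo
# `E(ℚ_p(ζ_{p^{m−1}}))` and `p·E₁`, an integral combination of the Galois conjugates of `c_m`; and the
# trace relations `Tr_{m/m−1} c_{m+1} + c_{m−1} ∈ E(ℚ_p)`

(Port of the declarations listed in the Part header; the source module's docstring — cell bookkeeping of the BSD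
printed-inputs programme — is abridged to its title here.)
-/

section Part12

open scoped _root_.Classical _root_.Topology _root_.NNReal
open _root_.Filter _root_.PowerSeries _root_.Finset

namespace Literature.NumberTheory.EllipticCurves.Sprung2012.Honda

namespace BallEval

open Literature.NumberTheory.GaloisRepresentations.LubinTate (unitBall mem_unitBall_iff)
open Literature.NumberTheory.EllipticCurves Literature.NumberTheory.EllipticCurves.FormalGroupChart
open _root_.WeierstrassCurve PadicCyclotomicTower HondaFss _root_.Field

variable (p : ℕ) [hp : Fact p.Prime] (M : WeierstrassCurve ℤ_[p])
  [hE : (M.map PadicInt.Coe.ringHom).IsElliptic] [hEt : (M.map PadicInt.toZMod).IsElliptic]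
  (hp2 : p ≠ 2) (htr : Literature.NumberTheory.EllipticCurves.HasseManin.tr (M.map PadicInt.toZMod) = 0)

variable {p M hp2 htr}
variable [hintΩ : (genFibΩ p M).IsIntegral (Valued.v (R := PadicAlgCl p)).integer]

/-! ## §1 Bookkeeping -/

omit hE hEt hintΩ in
/-- `L(m') ≤ L(m)` for `m' ≤ m`. [cite: Kobayashi2003, Prop. 8.11] -/
theorem subfieldPoints_layer_mono {m' m : ℕ} (h : m' ≤ m) :
    subfieldPoints (genFibΩ p M) (layer p m').toSubfield coeffs_mem_layer ≤ subfieldPoints (genFibΩ p M) (layer p m).toSubfield coeffs_mem_layer := by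
  intro Q hQ
  rcases Q with _ | ⟨x, y, hxy⟩
  · exact (subfieldPoints _ _ _).zero_mem
  · obtain ⟨hx, hy⟩ := (some_mem_subfieldPoints_iff _ hxy).mp hQ
    rw [some_mem_subfieldPoints_iff]
    exact ⟨layer_mono p h hx, layer_mono p h hy⟩

omit hEt in
/-- `Λ` of a finite sum of points of `L(m) ∩ E₁`. [cite: Kobayashi2003, Prop. 8.11] -/
theorem ptLogΩ_finset_sum {ι : Type*} (s : Finset ι) (Q : ι → (genFibΩ p M).toAffine.Point) {m : ℕ}
    (hL : ∀ i ∈ s, Q i ∈ subfieldPoints (genFibΩ p M) (layer p m).toSubfield coeffs_mem_layer)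
    (hk : ∀ i ∈ s, Q i ∈ kernel (Valued.v (R := PadicAlgCl p)) (genFibΩ p M)) :
    ptLogΩ p M (∑ i ∈ s, Q i) = ∑ i ∈ s, ptLogΩ p M (Q i) := by
  haveI := isIntegral_curveK p (LayerField p m) M
  induction s using Finset.induction_on with
  | empty => rw [sum_empty, sum_empty, ptLogΩ_zero]
  | @insert i s hi ih =>
    have hLs : ∀ j ∈ s, Q j ∈ subfieldPoints (genFibΩ p M) (layer p m).toSubfield coeffs_mem_layer := fun j hj => hL j (mem_insert_of_mem hj)
    have hks : ∀ j ∈ s, Q j ∈ kernel (Valued.v (R := PadicAlgCl p)) (genFibΩ p M) := fun j hj => hk j (mem_insert_of_mem hj)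
    rw [sum_insert hi, sum_insert hi, ptLogΩ_add (m := m) (hL i (mem_insert_self i s))
      ((subfieldPoints _ _ _).sum_mem hLs) (hk i (mem_insert_self i s))
      ((kernel (Valued.v (R := PadicAlgCl p)) (genFibΩ p M)).sum_mem hks), ih hLs hks]

omit hE hEt hintΩ in
/-- The Frobenius hypothesis of file 31 for `(K_m, K_{m−1})`, from the cyclotomic congruence of file 32.
[cite: Kobayashi2003, Prop. 8.11] -/
theorem frob_layerField (hp2 : p ≠ 2) {m : ℕ} (hm : 1 ≤ m) (y : LayerField p m) (hy : ‖y‖ ≤ 1) :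
    ∃ s ∈ Subfield.comap (LayerField.emb p m).toRingHom (layer p (m - 1)).toSubfield,
      ‖s‖ ≤ 1 ∧ ‖y ^ p - s‖ ≤ ‖(p : LayerField p m)‖ := by
  have hy' : ‖LayerField.emb p m y‖ ≤ 1 := by rwa [LayerField.norm_emb]
  obtain ⟨s, hs, hs1, hys⟩ := exists_frob_mem_layer_pred p hp2 hm (LayerField.emb_mem y) hy'
  refine ⟨LayerField.mk p m s (layer_mono p (Nat.sub_le m 1) hs), ?_, ?_, ?_⟩
  · change LayerField.emb p m (LayerField.mk p m s _) ∈ (layer p (m - 1)).toSubfield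
    rw [LayerField.emb_mk]; exact hs
  · rw [← LayerField.norm_emb, LayerField.emb_mk]; exact hs1
  · rw [← LayerField.norm_emb, map_sub, map_pow, LayerField.emb_mk, ← LayerField.norm_emb (p := p) (m := m) (p : LayerField p m),
      map_natCast]
    exact hys

end BallEval

end Literature.NumberTheory.EllipticCurves.Sprung2012.Honda

end Part12

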